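import Literature.MathematicalPhysics.QuantumFieldTheory.Balaban1983to89.B13NodeTorusWalksGammaLeaves
import Literature.MathematicalPhysics.QuantumFieldTheory.Balaban1983to89.NodeOLettersOfWalksPerturbative
import Literature.MathematicalPhysics.QuantumFieldTheory.Balaban1983to89.B13NodeTorusTermwiseHolo

/-!
# `Balaban1983to89.B13NodeTorusWalksHolo` — N10's WALKS LEAVES WITHOUT THE TWO REGULARITY HYPOTHESES `hΨσ ∕ hΨτ`: the twins of
# `B13NodeTorusWalksGammaLeaves.b13Leaf_twoTorus_walks₃` (q-currency) and `B13NodeTorusWalksRefLeaves.b13Leaf_twoTorus_walksRef`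
# (reference currency) over storeys 1–5 of the `hΨσ ∕ hΨτ`-free torus chain (`B13PrimitiveKernels216Holo`, `B13Lemma3TorusBindersHolo`,
# `B13NodeTorusTermwiseHolo`)

statement-level bookkeeping over published theorems with citation tags; kernel-checked compositions of tree theorems; nothing here is a
claim about the Yang–Mills mass gap.

Cell `pub-ymgap`, D-0062 Track A, node N10 = [Balaban1988RG2Cluster] Lemmas 1–3; seat `dag-n10-c` g2, module 15 = storey 6.

WHY.  After modules 1–12 of this seat, the displayed hypotheses of N10's Lemma-3 side that are neither NODE A's kernel data (the rung
`TermWalks`∕`TermWalksRef`, complex symmetry `hAs`, the definitional `hlin`) nor the dictionary (`hH`) were the two regularity letters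
`hΨσ ∕ hΨτ : SepHolOn U (σ∕τ ↦ core214 …)` — separate holomorphy of the (2.14) X-integral, an object INTERNAL to [B13]'s proof
(print p. 15: *"We consider it as an analytic function … of the complex parameters σ(Z), τ, and we estimate it using the Cauchy formula"*;
`B13Lemma3TorusSocket`: «analyticity: LOCATED-ROUTINE given the objects»).  THIS FILE removes them from the leaves: they are DERIVED
(holomorphy under the integral sign, ne5's `B13Core214Holomorphic*` ∕ `B13Bound226LocatedPoly`, through storeys 1–5) from KERNEL-LEVEL
data a supplier of NODE A's rung states anyway — the entries of `A(σ,u) = Δ^{(k)}(Z₀,σ)` and `G(σ,u)` are HOLOMORPHIC IN σ on an open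
polydisc containing the Cauchy contour (print p. 15: the quadratic forms are analytic functions of σ(Z); here the open `e^{κ₁⁺}`-ball,
`κ₁⁺ > κ₁`, NODE A's kernels being tagged at the bigger constants record `cp`, in which `TermKernels` is phantom) — plus measurability of
three RECORD objects in the bond variables (`χ_{k,Y₀}`, the potentials `𝐕_k(Y,·)`, the small-field region `{B | emb B ∈ (1.34)_Y ∀ Y ∈ 𝐃}`).

THE HONEST TRADE (both theorems; every other binder verbatim and in the same order as the twin).  REMOVED: `hΨσ hΨτ` and the region
binders `Uσ Uτ hUσ hUτ hUexp hUtau hsubτ hr'`.  ADDED: `(cp : B13.Consts) (hκp : c.κ₁ < cp.κ₁)`, `hr1 : r ≤ 1`, per term and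
configuration `hAhol hGhol` (σ-holomorphy of `(𝒦 Z t).A2 · (uOf Z t φ)`, `(𝒦 Z t).G2 · (uOf Z t φ)` entrywise on
`{σ | ∀ j, σ j ∈ ball 0 (e^{cp.κ₁})}`), `hχm hVm hsmallm`.  CHANGED: `𝒦 : … → TermKernels cp 4 N' ν Nf E₃` (the rung `TermWalks (𝒦 Z t) q` ∕
`TermWalksRef (𝒦 Z t) rf` is therefore asked on the polydisc of radius `e^{cp.κ₁}` ⊋ the Cauchy contour — print's «much bigger
analyticity space»); `hAs hlin` on the closed `e^{cp.κ₁}`-polydisc; print's letters `a₂₀ = m′α₄M⁻⁴(1+32∕(κ₁−1))⁴` (in `hαc ∕ hsmall ∕ hvol`)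
and `w = K₀(64,8)α₄#(⋃𝐃)` (in `hvol`) DOUBLED ((2.20) on the open τ-discs of radii `2|τ(Y)|`, storey 3).
* `b13Leaf_twoTorus_walksHolo` — twin of `b13Leaf_twoTorus_walks₃`; proof = the ₁∕₂∕₃ derivations of this lineage (`kernel216_of_termWalks_le`,
  `re_posDef_of_termWalks`, `eigenvalues_C_le_of_termWalks`, `gammaForm_le_of_termWalks`, `localisation17a_mono_rate`,
  `differences216_of_two` at `cp`) feeding `B13NodeTorusTermwiseHolo.b13Leaf_twoTorus_kernel216_holo`.
* `b13Leaf_twoTorus_walksRefHolo` — twin of `b13Leaf_twoTorus_walksRef` (reference currency, four perturbative thresholds), by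
  `termWalks_of_ref_thresholds` into the former.
* `termWalksRef_of_uniformWalksAcrossRef` (instance transport) and `b13Leaf_twoTorus_uniformWalksAcrossRefHolo` — twin of
  `b13Leaf_twoTorus_uniformWalksAcrossRef` (the FAN-OUT §N10 s3 shape `UniformWalksAcrossRef 𝓣 rf`, family tagged at `cp`), into the former.
WHAT REMAINS BY ASSERTION for N10's Lemma-3 side after this file, per term of the step: NODE A's reference datum `TermWalksRef (𝒦 Z t) rf`
for BAŁABAN's kernels on the bigger polydisc + their σ-holomorphy there + complex symmetry `hAs` ([13] Thms 3.10∕3.12 and (2.5)–(2.9);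
NODE A ∕ in-edge N06 ∕ the (D4) owner — NOT supplied); `hlin` (definitional); the dictionary `hH`; three measurabilities of record objects;
plus the located Lemma 1–2 inputs, the in-edges (1.24)∕(1.30), the numbers.  NO [B13]-internal regularity hypothesis remains.

CITATIONS.  [Balaban1988RG2Cluster] Lemmas 1–3 pp. 9, 11, 20; (1.11) p. 5, p. 13, p. 15, (2.7), (2.14)–(2.26) pp. 13–17.
[Balaban1985BackgroundPropagators] Thm 3.10 ∕ (3.108) p. 416, Thm 3.12 p. 423.  [Balaban1984PropagatorsII] Lemma 2.1 (2.61) p. 234.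

HONEST FRAMING: count-neutral Track-A side landing; N10 NOT discharged; NOTHING of Bałaban's operators is constructed or asserted; NOT
NODE O for Bałaban's family; NOT [B12] Thm 2; one finite T⁴ programme at fixed ε; nothing continuum ∕ ℝ⁴ ∕ OS ∕ mass-gap ∕ Clay.
0 `sorry`, 0 `def`, no instance, no notation, standard axioms.
-/

noncomputable section

namespace Literature.MathematicalPhysics.QuantumFieldTheory.Balaban1983to89.B13NodeTorusWalksHolo

open Metric Set
open Literature.MathematicalPhysics.QuantumFieldTheory.Balaban1983to89
open Literature.MathematicalPhysics.QuantumFieldTheory.Balaban1983to89.B16Absorption (pbox)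
open Literature.MathematicalPhysics.QuantumFieldTheory.Balaban1983to89.TreeLengthTorus
open Literature.MathematicalPhysics.QuantumFieldTheory.Balaban1983to89.TreeLengthTorusGeometry
open Literature.MathematicalPhysics.QuantumFieldTheory.Balaban1983to89.TreeLengthTorusTransfer
open Literature.MathematicalPhysics.QuantumFieldTheory.Balaban1983to89.B12TreeDecay (kappa₀ K₀)
open Literature.MathematicalPhysics.QuantumFieldTheory.Balaban1983to89.B13Lemma3TorusData
open Literature.MathematicalPhysics.QuantumFieldTheory.Balaban1983to89.B13Lemma3Torus (TwoTorusStep)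
open Literature.MathematicalPhysics.QuantumFieldTheory.Balaban1983to89.B13Lemma3TorusSocket (Lemma3Numerics)
open Literature.MathematicalPhysics.QuantumFieldTheory.Balaban1983to89.B13PkScaling (Qop scaled)
open Literature.MathematicalPhysics.QuantumFieldTheory.Balaban1983to89.DagBinding
open Literature.MathematicalPhysics.QuantumFieldTheory.Balaban1983to89.B13Bound143 (invTau R12)
open Literature.MathematicalPhysics.QuantumFieldTheory.Balaban1983to89.B13Term214 (term214 SepHolOn core214 F214)
open Literature.MathematicalPhysics.QuantumFieldTheory.Balaban1983to89.B13Lemma3TorusTerms (terms weight Z0)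
open Literature.MathematicalPhysics.QuantumFieldTheory.Balaban1983to89.B5TorusCover (UT)
open Literature.MathematicalPhysics.QuantumFieldTheory.Balaban1983to89.B9Thm37GlueTorus (tdist1)
open Literature.MathematicalPhysics.QuantumFieldTheory.Balaban1983to89.B13TermWalkData (TermKernels TorusTerms)
open Literature.MathematicalPhysics.QuantumFieldTheory.Balaban1983to89.NodeOLettersOfWalksAcross
  (WalkPackage RateBook TermWalks UniformWalksAcross)
open Literature.MathematicalPhysics.QuantumFieldTheory.Balaban1983to89.NodeOLettersOfWalksPerturbative
  (RefPackage TermWalksRef UniformWalksAcrossRef termWalks_of_ref_thresholds uniformWalksAcross_of_ref margin_of_thresholds)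
open Literature.MathematicalPhysics.QuantumFieldTheory.Balaban1983to89.B13NodeTorusWalks (kernel216_of_termWalks_le exchange_of_thresholds)
open Literature.MathematicalPhysics.QuantumFieldTheory.Balaban1983to89.B13NodeTorusWalksAccretive
  (re_posDef_of_termWalks eigenvalues_C_le_of_termWalks)
open Literature.MathematicalPhysics.QuantumFieldTheory.Balaban1983to89.B13NodeTorusWalksGammaForm (gammaForm_le_of_termWalks)
open Literature.MathematicalPhysics.QuantumFieldTheory.Balaban1983to89.NodeOKernel216 (Kernel216)
open Literature.MathematicalPhysics.QuantumFieldTheory.Balaban1983to89.B13PrimitiveKernels216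
  (localisation17a_mono_rate differences216_of_two)
open Literature.MathematicalPhysics.QuantumFieldTheory.Balaban1983to89.B13NodeTorusTermwiseHolo (b13Leaf_twoTorus_kernel216_holo)

/-! ## §1. The per-term walks leaf (q-currency), `hΨσ ∕ hΨτ` derived -/

section Walks

variable {L N' : ℕ} [NeZero L] [NeZero N']

open Matrix

open Classical in
/-- **N10's LEAF TRIPLE ON THE TWO-SCALE TORUS FROM THE W-WALKS RUNG, WITHOUT `hΨσ ∕ hΨτ`.**  Exactly
`B13NodeTorusWalksGammaLeaves.b13Leaf_twoTorus_walks₃` (p463673; same binders in the same order, same conclusion) except the module header's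
trade: `hΨσ hΨτ Uσ Uτ hUσ hUτ hUexp hUtau hsubτ hr'` REMOVED; `cp hκp hr1` and per-term `hAhol hGhol hχm hVm hsmallm` ADDED; NODE A's kernels
`𝒦 Z t : TermKernels cp …` (rung and `hAs hlin` on the bigger polydisc); `a₂₀`, `w` DOUBLED in `hαc ∕ hsmall ∕ hvol`.
[cite: Balaban1988RG2Cluster, Lemmas 1–3 pp.9, 11, 20; p.13, p.15, (2.14)–(2.26) pp.15–17; Balaban1985BackgroundPropagators, Thm 3.10 p.416] -/
theorem b13Leaf_twoTorus_walksHolo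
    (Wt : TwoTorusStep 4 L N') (c : B13.Consts) (k : ℕ) (hN12 : 12 ≤ L * N') (hL8 : 8 ≤ c.L) (hLc : c.L = L)
    -- (1) LEMMA 1: index data of (1.33)
    (S0 : TDom 4 (L * N') → Finset (TPt 4 (L * N')))
    (F : TDom 4 (L * N') → TPt 4 (L * N') → Finset (TPt 4 (L * N')))
    (Sq : TDom 4 (L * N') → TPt 4 (L * N') → (j : ℕ) → Finset (TPt 4 (L ^ (k - j) * (L * N'))))
    (SX : TDom 4 (L * N') → TPt 4 (L * N') → (j : ℕ) → TPt 4 (L ^ (k - j) * (L * N')) →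
      Finset (TDom 4 (L ^ (k - j) * (L * N'))))
    (T : TDom 4 (L * N') → TPt 4 (L * N') → Finset (TPt 4 (L * N')) → (j : ℕ) →
      TPt 4 (L ^ (k - j) * (L * N')) → TDom 4 (L ^ (k - j) * (L * N')) → Wt.Φ → ℂ)
    (Sc : TDom 4 (L * N') → Finset (TPt 4 (L * N')))
    (Sq' : TDom 4 (L * N') → TPt 4 (L * N') → (j : ℕ) → Finset (TPt 4 (L ^ (k - j) * (L * N'))))
    (SX' : TDom 4 (L * N') → TPt 4 (L * N') → (j : ℕ) → TPt 4 (L ^ (k - j) * (L * N')) →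
      Finset (TDom 4 (L ^ (k - j) * (L * N'))))
    (T' : TDom 4 (L * N') → TPt 4 (L * N') → (j : ℕ) → TPt 4 (L ^ (k - j) * (L * N')) →
      TDom 4 (L ^ (k - j) * (L * N')) → Wt.Φ → ℂ)
    (dist : TDom 4 (L * N') → TPt 4 (L * N') → (j : ℕ) → TPt 4 (L ^ (k - j) * (L * N')) → ℝ) {K K' : ℝ}
    (h133 : ∀ Y, Wt.Vp Y =
      (∑ a ∈ S0 Y, ∑ X ∈ (F Y a).powerset, ∑ j ∈ Finset.range (k + 1), ∑ q ∈ Sq Y a j,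
        ∑ x ∈ SX Y a j q, T Y a X j q x) +
      (∑ a ∈ Sc Y, ∑ j ∈ Finset.range (k + 1), ∑ q ∈ Sq' Y a j, ∑ x ∈ SX' Y a j q, T' Y a j q x))
    (hS0Y : ∀ Y, ∀ a ∈ S0 Y,
      (pbox (fun i => natLift a i - (5 : ℕ)) (fun i => natLift a i + 1 + (5 : ℕ))).image (proj (L * N')) ⊆ Y.1)
    (hFsub : ∀ Y a, F Y a ⊆
      (pbox (fun i => natLift a i - (5 : ℕ)) (fun i => natLift a i + 1 + (5 : ℕ))).image (proj (L * N')) \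
        (pbox (fun i => natLift a i - (4 : ℕ)) (fun i => natLift a i + 1 + (4 : ℕ))).image (proj (L * N')))
    (hSq : ∀ Y, ∀ a ∈ S0 Y, ∀ j, Sq Y a j ⊆ (Finset.univ : Finset (TPt 4 (L ^ (k - j) * (L * N')))).filter
      (fun q => tcoarse (L ^ (k - j)) (L * N') q ∈
        (pbox (fun i => natLift a i - (2 : ℕ)) (fun i => natLift a i + 1 + (2 : ℕ))).image (proj (L * N'))))
    (hScY : ∀ Y, Sc Y ⊆ Y.1)
    (hdist0 : ∀ Y a j q, 0 ≤ c.δ₀ * dist Y a j q)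
    (hdist : ∀ Y a j (n : ℕ) q, q ∉ (pbox (fun i => ((L ^ (k - j) : ℕ) : ℤ) * natLift a i - (n + 1 : ℕ))
      (fun i => ((L ^ (k - j) : ℕ) : ℤ) * natLift a i + 2 * ((L ^ (k - j) : ℕ) : ℤ) - 1 + (n + 1 : ℕ))).image
        (proj (L ^ (k - j) * (L * N'))) → c.δ₀ * c.M * ((n : ℝ) + 1) ≤ c.δ₀ * dist Y a j q)
    (hSX : ∀ Y a j q, SX Y a j q ⊆ (tcubeSys 4 (L ^ (k - j) * (L * N'))).above q)
    (hSX' : ∀ Y a j q, SX' Y a j q ⊆ (tcubeSys 4 (L ^ (k - j) * (L * N'))).above q)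
    (hX0 : ∀ Y, ∀ a ∈ Sc Y, ∀ j ∈ Finset.range (k + 1), ∀ q ∈ Sq' Y a j, ∀ x ∈ SX' Y a j q,
      x.1.image (tcoarse (L ^ (k - j)) (L * N')) ⊆ Y.1)
    -- (1) LEMMA 1: analyticity of the terms, closure of `Analytic`
    (hAdd : ∀ (s : Set Wt.Φ) (f g : Wt.Φ → ℂ), Wt.Analytic f s → Wt.Analytic g s → Wt.Analytic (f + g) s)
    (hZero : ∀ s : Set Wt.Φ, Wt.Analytic 0 s)
    (hAnT : ∀ Y, ∀ a ∈ S0 Y, ∀ X ∈ (F Y a).powerset, ∀ j ∈ Finset.range (k + 1), ∀ q ∈ Sq Y a j,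
      ∀ x ∈ SX Y a j q, Wt.Analytic (T Y a X j q x) (Wt.sp1 Y))
    (hAnT' : ∀ Y, ∀ a ∈ Sc Y, ∀ j ∈ Finset.range (k + 1), ∀ q ∈ Sq' Y a j, ∀ x ∈ SX' Y a j q,
      Wt.Analytic (T' Y a j q x) (Wt.sp1 Y))
    -- (1) LEMMA 1: thresholds and restrictions
    (hK : 0 ≤ K) (hK' : 0 ≤ K') (hκ : 0 ≤ c.κ) (hδ1 : c.δ < 1) (hδκ : 1 ≤ c.δ * c.κ)
    (hκ126 : kappa₀ 64 8 ≤ c.κ) (hκ126' : kappa₀ 64 8 ≤ c.δ * c.κ)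
    (hκ₁ : 1 + 2 * Real.log (8 * 12 ^ 3) ≤ c.κ₁) (hκ₁' : 2 + 16 * Real.log 128 ≤ c.κ₁)
    (hδ₀M : 10 * Real.exp (-1) ≤ c.δ₀ * c.M) (hδ₀M5 : 2 * Real.log 5 ≤ c.δ₀ * c.M)
    (hR8 : (1 - c.δ) * c.κ ≤ (1 / 4) * (c.κ₁ - 1)) (hR9 : (1 - 2 * c.δ) * c.κ ≤ (1 / 16) * c.κ₁)
    -- (1) LEMMA 1: per-term (1.24), (1.30) (IN-EDGES); the constants of (1.36) with headroom (1 − θ) for the local pieces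
    (h124 : ∀ Y φ, φ ∈ Wt.sp1 Y → ∀ a ∈ S0 Y, ∀ X ∈ (F Y a).powerset, ∀ j ∈ Finset.range (k + 1), ∀ q ∈ Sq Y a j,
      ∀ x ∈ SX Y a j q,
        ‖T Y a X j q x φ‖ ≤ K * ((L : ℝ) ^ j * ((L : ℝ) ^ k)⁻¹) ^ 5 *
          Real.exp (-(c.κ₁ - 1) *
            (((Y.1 \ (pbox (fun i => natLift a i - (5 : ℕ)) (fun i => natLift a i + 1 + (5 : ℕ))).image
              (proj (L * N'))).card : ℝ) + X.card)) *
          Real.exp (-(c.κ * torusTreeLen x.1)))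
    (h130 : ∀ Y φ, φ ∈ Wt.sp1 Y → ∀ a ∈ Sc Y, ∀ j ∈ Finset.range (k + 1), ∀ q ∈ Sq' Y a j,
      ∀ x ∈ SX' Y a j q,
        ‖T' Y a j q x φ‖ ≤ K' * Real.exp (-(1 / 2) * (c.δ₀ * c.M) * ((L : ℝ) ^ j * ((L : ℝ) ^ k)⁻¹)⁻¹
            - (1 / 2) * c.δ₀ * dist Y a j q) *
          Real.exp (-(c.κ₁ - 1) * ((Y.1 \ x.1.image (tcoarse (L ^ (k - j)) (L * N'))).card : ℝ)) *
          Real.exp (-(c.κ * torusTreeLen x.1)))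
    {θ : ℝ} (hθ0 : 0 ≤ θ) (hθ1 : θ < 1)
    (hC : K * K₀ 64 8 * (2 * (6 * (L : ℝ)) ^ 4) * Real.exp 1 * Real.exp ((1 / 8) * c.κ₁ * (12 ^ 4 - 1)) +
        2 * (64 * K') * K₀ 64 8 * 1344 ≤
      (1 - θ) * (c.E₀ * c.ε₁ * c.C₁ * c.M ^ c.q * Real.exp (c.C₂ * c.κ₁)))
    -- (2) LEMMA 2 (pp. 10–11): V″_k = V′_k + the local pieces G of P^{(k)}, analytic and (1.36)-small at prefactor θ
    (Gl : TDom 4 (L * N') → Wt.Φ → ℂ) (hVpp : ∀ Y, Wt.Vpp Y = fun φ => Wt.Vp Y φ + Gl Y φ)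
    (hGlAn : ∀ Y, Wt.Analytic (Gl Y) (Wt.sp1 Y))
    (hGl : ∀ Y φ, φ ∈ Wt.sp1 Y → ‖Gl Y φ‖ ≤ θ * (c.E₀ * c.ε₁ * c.C₁ * c.M ^ c.q * Real.exp (c.C₂ * c.κ₁)) *
      Real.exp (-((1 - 2 * c.δ) * c.κ * (tsys 4 (L * N')).dj Y)))
    -- (2) LEMMA 2: the located per-term data of `B13Lemma2Torus.lemma2Printed_twoTorus'`
    {E : Type*} [NormedAddCommGroup E] [NormedSpace ℂ E]
    (rd : TDom 4 (L * N') → Wt.Φ → E) (e : TDom 4 (L * N') → Wt.Bond → E) (he : ∀ Y b, ‖e Y b‖ ≤ 1)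
    (hrd : ∀ Y φ, rd Y φ = haveI := Wt.finBond; ∑ b, Wt.Bv φ b • e Y b)
    {ι₂ : Type*} (s : TDom 4 (L * N') → Finset ι₂) (Wf : TDom 4 (L * N') → ι₂ → Wt.Φ → E → ℂ) {g : ℂ} (hg : g ≠ 0)
    {R K₂ : ℝ} {m₂ : ℕ} (hK₂ : 0 ≤ K₂) (hR : 0 < R) (h3 : 3 * c.ε₁ ≤ R)
    (hW : ∀ Y, ∀ i ∈ s Y, ∀ φ ∈ Wt.sp1 Y, AnalyticOnNhd ℂ (Wf Y i φ) (ball 0 R))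
    (hKW : ∀ Y, ∀ i ∈ s Y, ∀ φ ∈ Wt.sp1 Y, ∀ z ∈ ball (0 : E) R,
      ‖Wf Y i φ z‖ ≤ K₂ * Real.exp (-(c.κ₁ - 1) * ((Y.1.card : ℝ) - 1)) * ‖z‖ ^ 3)
    (hcard : ∀ Y, (s Y).card ≤ m₂ * Y.1.card)
    (hV : ∀ Y, Wt.V Y = fun φ => (∑ i ∈ s Y, scaled g (Wf Y i φ) (rd Y φ)) + Wt.Vpp Y φ)
    (hQ : ∀ Y φ (b b' : Wt.Bond), φ ∈ Wt.sp1 Y →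
      Wt.Q Y φ b b' = 2 * ∑ i ∈ s Y, Qop (scaled g (Wf Y i φ)) (rd Y φ) (e Y b) (e Y b'))
    (hsp : ∀ Y φ, φ ∈ Wt.sp1 Y → ‖g‖ * ‖rd Y φ‖ < c.ε₁)
    (hvolk : ∀ Y, Wt.volk Y = Y.1.card)
    (hfloor : 27 * m₂ * K₂ * Real.exp (c.κ₁ - 1) ≤ c.C₃ * c.M ^ 4 * Real.exp (c.C₂ * c.κ₁))
    (hAnP : ∀ Y, ∀ i ∈ s Y, Wt.Analytic (fun φ => scaled g (Wf Y i φ) (rd Y φ)) (Wt.sp1 Y))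
    (hG : ∀ Y, Wt.GaugeInv (Wt.V Y) ∧ Wt.GaugeInv (Wt.toStepData.quadForm Y) ∧ Wt.GaugeInv (Wt.Vpp Y))
    -- (3) LEMMA 3 (pp. 14–20): the signs of (2.18)–(2.20), R12, |τ(Y)| ≥ 2, and the numerics bundle at ℓ = ½L
    (M₃ : ℕ) [NeZero M₃] {a a₂ a₂' a₅ Aabs : ℝ} (hN : Lemma3Numerics c M₃ ((c.L : ℝ) / 2) a a₂ a₂' a₅ Aabs)
    (h12 : R12 c) (hE : 0 < c.E₀) (hε : 0 < c.ε₁) (hC₁ : 0 < c.C₁) (hα : 0 < c.α₄) (hM : 1 ≤ c.M)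
    (hτ2 : c.E₀ * c.ε₁ * c.C₁ * c.α₄⁻¹ * c.M ^ c.q * Real.exp (c.C₂ * c.κ₁) ≤ 1 / 2)
    -- (3) the Cauchy radius and the parameter domains (p. 15)
    -- the bigger σ-polydisc (a second constants record `cp` lending its `κ₁`; NODE A's kernels are tagged at `cp`) and a
    -- Cauchy radius `r ≤ 1`; the τ-regions are the open discs of radii `2|τ(Y)|` (chosen inside)
    (cp : B13.Consts) (hκp : c.κ₁ < cp.κ₁) {r : ℝ} (hr : 0 < r) (hr1 : r ≤ 1)
    -- (3) THE DICTIONARY: per term (𝐃, P) of every Z ∈ 𝐃_{k+1}, the kernel data `𝒦 Z t` on a site torus `UT Nf` with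
    --     configuration space `E₃`, and the configuration `u = uOf Z t φ` of `φ ∈ sp2 Z`, of size ≤ α
    {ν : ℕ} {Nf : Fin ν → ℕ} [∀ i, NeZero (Nf i)]
    {E₃ : Type*} [NormedAddCommGroup E₃] [NormedSpace ℂ E₃]
    (𝒦 : TDom 4 N' → Finset (TDom 4 (L * N')) × Finset (TBond 4 M₃ (L * N')) → TermKernels cp 4 N' ν Nf E₃)
    [∀ Z t, Fintype (𝒦 Z t).C₀] [∀ Z t, DecidableEq (𝒦 Z t).C₀]
    (uOf : (Z : TDom 4 N') → (t : Finset (TDom 4 (L * N')) × Finset (TBond 4 M₃ (L * N'))) → Wt.Φ → E₃)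
    {α : ℝ} (hαnn : 0 ≤ α) (huα : ∀ Z, ∀ t ∈ terms L M₃ Z, ∀ φ ∈ Wt.sp2 Z, ‖uOf Z t φ‖ ≤ α)
    -- (3) per term: parameter lists, the linear map Γ(σ), characteristic functions, potentials
    (lZ : TDom 4 N' → Finset (TDom 4 (L * N')) × Finset (TBond 4 M₃ (L * N')) → List (TPt 4 N'))
    (hlZ : ∀ Z, ∀ t ∈ terms L M₃ Z, (lZ Z t).Nodup ∧ (lZ Z t).toFinset = Z.1 \ tclosure L N' (Z0 M₃ t))
    (lD : TDom 4 N' → Finset (TDom 4 (L * N')) × Finset (TBond 4 M₃ (L * N')) → List (TDom 4 (L * N')))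
    (hlD : ∀ Z, ∀ t ∈ terms L M₃ Z, (lD Z t).Nodup ∧ (lD Z t).toFinset = t.1)
    (Γm : (Z : TDom 4 N') → (t : Finset (TDom 4 (L * N')) × Finset (TBond 4 M₃ (L * N'))) → Wt.Φ →
      (TPt 4 N' → ℂ) → ((𝒦 Z t).Λ ⊕ (𝒦 Z t).C₀ → ℝ) → ((𝒦 Z t).Λ → ℂ))
    (χY₀ χcP : (Z : TDom 4 N') → (t : Finset (TDom 4 (L * N')) × Finset (TBond 4 M₃ (L * N'))) →
      ((𝒦 Z t).Λ → ℝ) → ℝ)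
    (hχ0 : ∀ Z t B, 0 ≤ χY₀ Z t B) (hχ1 : ∀ Z t B, χY₀ Z t B ≤ 1)
    (Pl : (Z : TDom 4 N') → (t : Finset (TDom 4 (L * N')) × Finset (TBond 4 M₃ (L * N'))) → Finset (𝒦 Z t).Λ)
    (hPcard : ∀ Z, ∀ t ∈ terms L M₃ Z, (Pl Z t).card = t.2.card) {rP : ℝ} (hrP : 0 ≤ rP)
    (hχc : ∀ Z t B, χcP Z t B = ∏ b ∈ Pl Z t, (if rP ≤ |B b| then (1 : ℝ) else 0))
    (Dfam : TDom 4 N' → Finset (TDom 4 (L * N')) × Finset (TBond 4 M₃ (L * N')) → Finset (TDom 4 (L * N')))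
    (Vr : (Z : TDom 4 N') → (t : Finset (TDom 4 (L * N')) × Finset (TBond 4 M₃ (L * N'))) → Wt.Φ →
      TDom 4 (L * N') → ((𝒦 Z t).Λ → ℝ) → ℂ)
    -- (3) termwise domination: ‖H(Z)‖ ≤ Σ_{(𝐃,P)} ‖(2.14)‖ on the space of p. 15 ((2.9)/(2.14))
    (hH : ∀ (Z : TDom 4 N') (φ : Wt.Φ), φ ∈ Wt.sp2 Z → ‖Wt.H Z φ‖ ≤
      ∑ t ∈ terms L M₃ Z, ‖term214 r (lZ Z t) (lD Z t)
        (core214 (fun σ => (𝒦 Z t).A2 σ (uOf Z t φ)) (Γm Z t φ)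
          (F214 t.2.card (χY₀ Z t) (χcP Z t) (Dfam Z t) (Vr Z t φ))) 0 0‖)
    -- (3) the record's objects behind the terms: bonds, cubes, the real field inside the configurations
    (ιb : (Z : TDom 4 N') → (t : Finset (TDom 4 (L * N')) × Finset (TBond 4 M₃ (L * N'))) → (𝒦 Z t).Λ → Wt.Bond)
    (hι : ∀ Z t, Function.Injective (ιb Z t)) (cube : Wt.Bond → TPt 4 (L * N'))
    (hQsupp : ∀ (Y : TDom 4 (L * N')) φ b b', Wt.Q Y φ b b' ≠ 0 → cube b ∈ Y.1 ∧ cube b' ∈ Y.1)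
    {m' : ℕ} (hfibc : ∀ Z t (x : TPt 4 (L * N')), (Finset.univ.filter fun j => cube (ιb Z t j) = x).card ≤ m')
    (emb : (Z : TDom 4 N') → (t : Finset (TDom 4 (L * N')) × Finset (TBond 4 M₃ (L * N'))) → Wt.Φ →
      ((𝒦 Z t).Λ → ℝ) → Wt.Φ)
    (hBv : ∀ Z t φ B b, Wt.Bv (emb Z t φ B) (ιb Z t b) = (B b : ℂ))
    (hBv0 : ∀ Z t φ B b', b' ∉ Set.range (ιb Z t) → Wt.Bv (emb Z t φ B) b' = 0)
    (hVr : ∀ Z, ∀ t ∈ terms L M₃ Z, ∀ φ ∈ Wt.sp2 Z, ∀ Y ∈ Dfam Z t, ∀ B,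
      emb Z t φ B ∈ Wt.sp1 Y → Vr Z t φ Y B = Wt.V Y (emb Z t φ B))
    (hχsupp : ∀ Z, ∀ t ∈ terms L M₃ Z, ∀ φ ∈ Wt.sp2 Z, ∀ B, χY₀ Z t B ≠ 0 → ∀ Y ∈ Dfam Z t,
      emb Z t φ B ∈ Wt.sp1 Y)
    -- (3) REPLACES the separate holomorphy `hΨσ ∕ hΨτ` of the X-integral: NODE A's kernels `A(σ,u)`, `G(σ,u)` entrywise
    --     HOLOMORPHIC IN σ on the open `e^{κ₁⁺}`-polydisc at the configuration (print p. 15: analytic functions of σ(Z)),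
    --     and measurability of the record's `χ_{k,Y₀}`, potentials, small-field region in the bond variables
    (hAhol : ∀ Z, ∀ t ∈ terms L M₃ Z, ∀ φ ∈ Wt.sp2 Z, ∀ i j, DifferentiableOn ℂ (fun σ => (𝒦 Z t).A2 σ (uOf Z t φ) i j)
      {σ : TPt 4 N' → ℂ | ∀ j, σ j ∈ Metric.ball (0 : ℂ) (Real.exp cp.κ₁)})
    (hGhol : ∀ Z, ∀ t ∈ terms L M₃ Z, ∀ φ ∈ Wt.sp2 Z, ∀ i j, DifferentiableOn ℂ (fun σ => (𝒦 Z t).G2 σ (uOf Z t φ) i j)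
      {σ : TPt 4 N' → ℂ | ∀ j, σ j ∈ Metric.ball (0 : ℂ) (Real.exp cp.κ₁)})
    (hχm : ∀ Z t, Measurable (χY₀ Z t)) (hVm : ∀ Z t φ Y, Measurable (Vr Z t φ Y))
    (hsmallm : ∀ Z t φ, MeasurableSet {B : (𝒦 Z t).Λ → ℝ | ∀ Y ∈ Dfam Z t, emb Z t φ B ∈ Wt.sp1 Y})
    -- (3) NODE A's structural inputs at the configuration: A(σ) COMPLEX SYMMETRIC on the polydisc; Γ(σ) = G(σ)·
    --     (`Re A(σ) ≻ 0` is no longer asked: it follows from the rung's m_A-accretivity, `re_posDef_of_termWalks`)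
    (hAs : ∀ Z, ∀ t ∈ terms L M₃ Z, ∀ φ ∈ Wt.sp2 Z, ∀ σ : TPt 4 N' → ℂ, (∀ j, ‖σ j‖ ≤ Real.exp cp.κ₁) →
      ((𝒦 Z t).A2 σ (uOf Z t φ)).IsSymm)
    (hlin : ∀ Z, ∀ t ∈ terms L M₃ Z, ∀ φ ∈ Wt.sp2 Z, ∀ σ : TPt 4 N' → ℂ, (∀ j, ‖σ j‖ ≤ Real.exp cp.κ₁) →
      ∀ X : (𝒦 Z t).Λ ⊕ (𝒦 Z t).C₀ → ℝ, Γm Z t φ σ X = (𝒦 Z t).G2 σ (uOf Z t φ) *ᵥ fun j => (X j : ℂ))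
    {γ₂ : ℝ} (hγ₂ : 0 ≤ γ₂)
    -- (3) uniform fibre bounds of the bond locations
    {m : ℕ}
    (hfibΛ : ∀ Z t (x : UT Nf), (Finset.univ.filter fun i => (𝒦 Z t).locΛ i = x).card ≤ m)
    (hfibN : ∀ Z t (x : UT Nf), (Finset.univ.filter fun j => (𝒦 Z t).locN j = x).card ≤ m)
    -- (3) THE W-WALKS RUNG ON THE TERMS OF THE STEP (the displayed hypothesis): ONE package, a rate book, round letters
    (q : WalkPackage) (hq : q.Admissible) (hp : q.PositiveRates) (hη : q.η ≤ q.etaMax) (hη0 : 0 < q.η)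
    (rb : RateBook q) (hκC : 0 < rb.κC) (hκCρ : rb.κC ≤ rb.ρ') (hαR : α < q.R)
    (hwalks : ∀ Z, ∀ t ∈ terms L M₃ Z, TermWalks (𝒦 Z t) q)
    {KG KCs θ₀ : ℝ} (hKG : q.Kbar ≤ KG) (hKCs : 4 / q.mA ≤ KCs)
    (hθ : 2 * q.Kbar * (Real.exp (-((rb.ρ' - rb.κC) * q.Rσ)) + α / q.R) ≤ θ₀)
    -- (3) rates below the rung's κ_C, and NODE A's letter ϑ (θ_Γ = θ_E = θ₀, K_Γ = K_G, K₀′ = K_Cs, θ_C derived)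
    {kap kap' kap'' kap₂ ϑ : ℝ} (hkap'' : 0 < kap'') (hk1 : kap'' < kap') (hk2 : kap' < kap) (hk3 : kap < kap₂)
    (hk4 : kap₂ < rb.κC) (hθ₀le : θ₀ ≤ ϑ)
    (hθR1le : (m * (1 + 2 / (kap - kap')) ^ ν) * (m * (1 + 2 / (kap' - kap'')) ^ ν)
      * (θ₀ * KCs * KG
        + KG * (KCs * θ₀ * (m * (1 + 2 / (rb.κC - kap₂)) ^ ν) * KCs * (m * (1 + 2 / (kap₂ - kap)) ^ ν)) * KG
        + KG * KCs * θ₀) ≤ ϑ)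
    (hsmallKθ : KCs * (m * (1 + 2 / kap) ^ ν) * (ϑ * (m * (1 + 2 / kap'') ^ ν)) < 1)
    -- (3) the (2.24)–(2.25) smallness with `a₂₀ = 2·m′·α₄·M⁻⁴(1 + 32/(κ₁−1))⁴`; the eigenvalue bound of C is the NUMBER
    --     `1∕m_A ≤ cE`; the form bound of Γ₀ is the NUMBER `g_q = B_Γ²c_V·m c₀(1,η)^ν∕m_A` (`gammaForm_le_of_termWalks`)
    {cE : ℝ} (hc0 : 0 ≤ cE)
    (hcE : 1 / q.mA ≤ cE)
    (hαc : (2 * (ϑ * (m * (1 + 2 / kap'') ^ ν)) +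
      (γ₂ + 2 * (m' * c.α₄ * (c.M ^ 4)⁻¹ * (1 + 32 / (c.κ₁ - 1)) ^ 4))) * cE ≤ 1 / 2)
    (hsmall : (2 * (ϑ * (m * (1 + 2 / kap'') ^ ν)) +
      (γ₂ + 2 * (m' * c.α₄ * (c.M ^ 4)⁻¹ * (1 + 32 / (c.κ₁ - 1)) ^ 4))) * (1 + 2 * cE * ((q.BΓ * q.cV) * (q.BΓ * (m * B6.c0 1 q.η ^ ν)) / q.mA)) ≤ 1 / 2)
    -- (3) constant matching, p. 17: `a ≤ γ₂ r_P²` and the volume factor with `w = 2·K₀(64,8)·α₄·#(⋃𝐃)`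
    (hPa : a ≤ γ₂ * rP ^ 2)
    (hvol : ∀ Z, ∀ t ∈ terms L M₃ Z,
      2 * (KCs * (m * (1 + 2 / kap) ^ ν) * (ϑ * (m * (1 + 2 / kap'') ^ ν))
              * (1 + (1 - KCs * (m * (1 + 2 / kap) ^ ν) * (ϑ * (m * (1 + 2 / kap'') ^ ν)))⁻¹) / 2)
          * (Fintype.card (𝒦 Z t).Λ : ℝ)
        + 2 * (K₀ 64 8 * c.α₄ * ((((Dfam Z t).image Subtype.val).biUnion id).card : ℝ))
        + (2 * (ϑ * (m * (1 + 2 / kap'') ^ ν)) +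
            (γ₂ + 2 * (m' * c.α₄ * (c.M ^ 4)⁻¹ * (1 + 32 / (c.κ₁ - 1)) ^ 4))) * cE * (Fintype.card (𝒦 Z t).Λ : ℝ)
        + (2 * (ϑ * (m * (1 + 2 / kap'') ^ ν)) +
            (γ₂ + 2 * (m' * c.α₄ * (c.M ^ 4)⁻¹ * (1 + 32 / (c.κ₁ - 1)) ^ 4))) * (1 + 2 * cE * ((q.BΓ * q.cV) * (q.BΓ * (m * B6.c0 1 q.η ^ ν)) / q.mA))
            * (Fintype.card ((𝒦 Z t).Λ ⊕ (𝒦 Z t).C₀) : ℝ)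
        ≤ a₅ * ((Z.1).card : ℝ)) :
    B13.Lemma1Printed Wt.toStepData c ∧ B13.Lemma2Printed Wt.toStepData c ∧ B13.Lemma3Printed Wt.toStepData c := by
  -- NODE A's `hA` (Re A ≻ 0 on the bigger polydisc) and the eigenvalue bound of `C`, from the rung's accretivity (₂)
  have hA : ∀ Z, ∀ t ∈ terms L M₃ Z, ∀ φ ∈ Wt.sp2 Z, ∀ σ : TPt 4 N' → ℂ, (∀ j, ‖σ j‖ ≤ Real.exp cp.κ₁) →
      (((𝒦 Z t).A2 σ (uOf Z t φ)).map Complex.re).PosDef := fun Z t ht φ hφ σ hσ =>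
    re_posDef_of_termWalks hq (hwalks Z t ht) ((huα Z t ht φ hφ).trans_lt hαR) σ hσ (hAs Z t ht φ hφ σ hσ)
  have hcE' : ∀ Z, ∀ t ∈ terms L M₃ Z, ∀ i, (𝒦 Z t).hC.1.eigenvalues i ≤ cE := fun Z t ht i =>
    (eigenvalues_C_le_of_termWalks hq (hwalks Z t ht) i).trans hcE
  -- NODE A's form bound of `Γ₀` is the package's number (₃)
  have hgq : 0 ≤ (q.BΓ * q.cV) * (q.BΓ * (m * B6.c0 1 q.η ^ ν)) / q.mA :=
    div_nonneg (mul_nonneg (mul_nonneg (WalkPackage.BΓ_nonneg hq) hq.hcV)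
      (mul_nonneg (WalkPackage.BΓ_nonneg hq)
        (mul_nonneg (Nat.cast_nonneg m) (pow_nonneg (RefPackage.c0_nonneg hη0) ν)))) hq.hmA.le
  have hΓq : ∀ Z, ∀ t ∈ terms L M₃ Z, ∀ X : (𝒦 Z t).Λ ⊕ (𝒦 Z t).C₀ → ℝ,
      ((𝒦 Z t).Γ₀ *ᵥ X) ⬝ᵥ ((𝒦 Z t).C *ᵥ ((𝒦 Z t).Γ₀ *ᵥ X)) ≤
        (q.BΓ * q.cV) * (q.BΓ * (m * B6.c0 1 q.η ^ ν)) / q.mA * (X ⬝ᵥ X) := fun Z t ht X =>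
    gammaForm_le_of_termWalks hq hp hη hη0 (hwalks Z t ht) (hfibΛ Z t) le_rfl X
  -- signs of the round letters and of θ₀ (₁)
  have hKG0 : 0 ≤ KG := (WalkPackage.Kbar_nonneg hq).trans hKG
  have hKCs0 : 0 ≤ KCs := le_trans (by have := hq.hmA; positivity) hKCs
  have hsum : 0 ≤ Real.exp (-((rb.ρ' - rb.κC) * q.Rσ)) + α / q.R :=
    add_nonneg (Real.exp_pos _).le (div_nonneg hαnn hq.hR.le)
  have hθ₀nn : 0 ≤ θ₀ :=
    le_trans (mul_nonneg (mul_nonneg zero_le_two (WalkPackage.Kbar_nonneg hq)) hsum) hθ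
  have hkap0 : 0 ≤ kap := (hkap''.trans (hk1.trans hk2)).le
  -- per term: NODE O's (2.16)-level record from the rung, in the round letters — at the bigger polydisc's `cp`
  have hKer : ∀ Z, ∀ t ∈ terms L M₃ Z, Kernel216 (𝒦 Z t) α rb.κC KG KCs θ₀ θ₀ := fun Z t ht =>
    kernel216_of_termWalks_le hq rb (hwalks Z t ht) hκC hκCρ hαnn hαR hKG hKCs hθ
  have hθC : 0 ≤ KCs * θ₀ * (m * (1 + 2 / (rb.κC - kap₂)) ^ ν) * KCs * (m * (1 + 2 / (kap₂ - kap)) ^ ν) := by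
    have hd12 : 0 < rb.κC - kap₂ := sub_pos.2 hk4
    have hd2k : 0 < kap₂ - kap := sub_pos.2 hk3
    have ha : 0 ≤ (m : ℝ) * (1 + 2 / (rb.κC - kap₂)) ^ ν :=
      mul_nonneg (Nat.cast_nonneg m) (pow_nonneg (by positivity) ν)
    have hb : 0 ≤ (m : ℝ) * (1 + 2 / (kap₂ - kap)) ^ ν :=
      mul_nonneg (Nat.cast_nonneg m) (pow_nonneg (by positivity) ν)
    exact mul_nonneg (mul_nonneg (mul_nonneg (mul_nonneg hKCs0 hθ₀nn) ha) hKCs0) hb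
  exact b13Leaf_twoTorus_kernel216_holo Wt c k hN12 hL8 hLc S0 F Sq SX T Sc Sq' SX' T' dist h133 hS0Y hFsub hSq hScY
    hdist0 hdist hSX hSX' hX0 hAdd hZero hAnT hAnT' hK hK' hκ hδ1 hδκ hκ126 hκ126' hκ₁ hκ₁' hδ₀M hδ₀M5 hR8 hR9
    h124 h130 hθ0 hθ1 hC Gl hVpp hGlAn hGl rd e he hrd s Wf hg hK₂ hR h3 hW hKW hcard hV hQ hsp hvolk hfloor hAnP
    hG M₃ hN h12 hE hε hC₁ hα hM hτ2 cp hκp hr hr1 (fun Z t => (𝒦 Z t).Λ)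
    (fun Z t => (𝒦 Z t).C₀) lZ hlZ lD hlD (fun Z t φ σ => (𝒦 Z t).A2 σ (uOf Z t φ)) Γm χY₀ χcP hχ0 hχ1 Pl
    hPcard hrP hχc Dfam Vr hH ιb hι cube hQsupp hfibc emb hBv hBv0 hVr hχsupp hAhol hχm hVm hsmallm
    (fun Z t _ => (𝒦 Z t).C) (fun Z t _ => (𝒦 Z t).Γ₀) (fun Z t φ σ => (𝒦 Z t).G2 σ (uOf Z t φ)) hAs hA hlin hGhol hγ₂
    (fun Z t => (𝒦 Z t).locΛ) (fun Z t => (𝒦 Z t).locN) hfibΛ hfibN hkap'' hk1 hk2 hθ₀nn hθ₀nn hθC hKG0 hKG0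
    hKCs0 hKCs0 hθ₀le hθ₀le hθR1le
    (fun Z t ht φ hφ => localisation17a_mono_rate (hk3.trans hk4).le hKG0 hKG0 hKCs0 hKCs0
      ((hKer Z t ht).localisation17a hαnn (huα Z t ht φ hφ)))
    (fun Z t ht φ hφ => differences216_of_two cp (𝒦 Z t).hC (hAs Z t ht φ hφ) (hA Z t ht φ hφ) (𝒦 Z t).locΛ
      (𝒦 Z t).locN (hfibΛ Z t) hkap0 hk3 hk4 hKCs0 hKCs0 hθ₀nn hθ₀nn
      ((hKer Z t ht).localisation17a hαnn (huα Z t ht φ hφ))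
      (fun σ hσ => (hKer Z t ht).dΓ σ hσ _ (huα Z t ht φ hφ))
      (fun σ hσ => (hKer Z t ht).dE σ hσ _ (huα Z t ht φ hφ)))
    hsmallKθ hc0 (fun Z t ht φ _ => ⟨(𝒦 Z t).hC, hcE' Z t ht⟩) hαc hgq (fun Z t ht φ _ X => hΓq Z t ht X) hsmall
    hPa hvol

end Walks

/-! ## §2. The per-term walks leaf keyed by the reference rung, `hΨσ ∕ hΨτ` derived -/

section Ref

variable {L N' : ℕ} [NeZero L] [NeZero N']

open Matrix

open Classical in
/-- **N10's LEAF TRIPLE ON THE TWO-SCALE TORUS FROM THE REFERENCE RUNG, WITHOUT `hΨσ ∕ hΨτ`.**  Exactly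
`B13NodeTorusWalksRefLeaves.b13Leaf_twoTorus_walksRef` (p467638; same binders in the same order, same conclusion) except the module header's
trade.  Proof: `b13Leaf_twoTorus_walksHolo` at `q := rf.toWalkPackage R₁`, `hwalks := termWalks_of_ref_thresholds` per term.
[cite: Balaban1988RG2Cluster, Lemmas 1–3 pp.9, 11, 20; p.13, p.15, (2.14)–(2.26) pp.15–17; Balaban1985BackgroundPropagators, Thm 3.10 p.416, Thm 3.12 p.423] -/
theorem b13Leaf_twoTorus_walksRefHolo
    (Wt : TwoTorusStep 4 L N') (c : B13.Consts) (k : ℕ) (hN12 : 12 ≤ L * N') (hL8 : 8 ≤ c.L) (hLc : c.L = L)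
    -- (1) LEMMA 1: index data of (1.33)
    (S0 : TDom 4 (L * N') → Finset (TPt 4 (L * N')))
    (F : TDom 4 (L * N') → TPt 4 (L * N') → Finset (TPt 4 (L * N')))
    (Sq : TDom 4 (L * N') → TPt 4 (L * N') → (j : ℕ) → Finset (TPt 4 (L ^ (k - j) * (L * N'))))
    (SX : TDom 4 (L * N') → TPt 4 (L * N') → (j : ℕ) → TPt 4 (L ^ (k - j) * (L * N')) →
      Finset (TDom 4 (L ^ (k - j) * (L * N'))))
    (T : TDom 4 (L * N') → TPt 4 (L * N') → Finset (TPt 4 (L * N')) → (j : ℕ) →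
      TPt 4 (L ^ (k - j) * (L * N')) → TDom 4 (L ^ (k - j) * (L * N')) → Wt.Φ → ℂ)
    (Sc : TDom 4 (L * N') → Finset (TPt 4 (L * N')))
    (Sq' : TDom 4 (L * N') → TPt 4 (L * N') → (j : ℕ) → Finset (TPt 4 (L ^ (k - j) * (L * N'))))
    (SX' : TDom 4 (L * N') → TPt 4 (L * N') → (j : ℕ) → TPt 4 (L ^ (k - j) * (L * N')) →
      Finset (TDom 4 (L ^ (k - j) * (L * N'))))
    (T' : TDom 4 (L * N') → TPt 4 (L * N') → (j : ℕ) → TPt 4 (L ^ (k - j) * (L * N')) →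
      TDom 4 (L ^ (k - j) * (L * N')) → Wt.Φ → ℂ)
    (dist : TDom 4 (L * N') → TPt 4 (L * N') → (j : ℕ) → TPt 4 (L ^ (k - j) * (L * N')) → ℝ) {K K' : ℝ}
    (h133 : ∀ Y, Wt.Vp Y =
      (∑ a ∈ S0 Y, ∑ X ∈ (F Y a).powerset, ∑ j ∈ Finset.range (k + 1), ∑ q ∈ Sq Y a j,
        ∑ x ∈ SX Y a j q, T Y a X j q x) +
      (∑ a ∈ Sc Y, ∑ j ∈ Finset.range (k + 1), ∑ q ∈ Sq' Y a j, ∑ x ∈ SX' Y a j q, T' Y a j q x))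
    (hS0Y : ∀ Y, ∀ a ∈ S0 Y,
      (pbox (fun i => natLift a i - (5 : ℕ)) (fun i => natLift a i + 1 + (5 : ℕ))).image (proj (L * N')) ⊆ Y.1)
    (hFsub : ∀ Y a, F Y a ⊆
      (pbox (fun i => natLift a i - (5 : ℕ)) (fun i => natLift a i + 1 + (5 : ℕ))).image (proj (L * N')) \
        (pbox (fun i => natLift a i - (4 : ℕ)) (fun i => natLift a i + 1 + (4 : ℕ))).image (proj (L * N')))
    (hSq : ∀ Y, ∀ a ∈ S0 Y, ∀ j, Sq Y a j ⊆ (Finset.univ : Finset (TPt 4 (L ^ (k - j) * (L * N')))).filter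
      (fun q => tcoarse (L ^ (k - j)) (L * N') q ∈
        (pbox (fun i => natLift a i - (2 : ℕ)) (fun i => natLift a i + 1 + (2 : ℕ))).image (proj (L * N'))))
    (hScY : ∀ Y, Sc Y ⊆ Y.1)
    (hdist0 : ∀ Y a j q, 0 ≤ c.δ₀ * dist Y a j q)
    (hdist : ∀ Y a j (n : ℕ) q, q ∉ (pbox (fun i => ((L ^ (k - j) : ℕ) : ℤ) * natLift a i - (n + 1 : ℕ))
      (fun i => ((L ^ (k - j) : ℕ) : ℤ) * natLift a i + 2 * ((L ^ (k - j) : ℕ) : ℤ) - 1 + (n + 1 : ℕ))).image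
        (proj (L ^ (k - j) * (L * N'))) → c.δ₀ * c.M * ((n : ℝ) + 1) ≤ c.δ₀ * dist Y a j q)
    (hSX : ∀ Y a j q, SX Y a j q ⊆ (tcubeSys 4 (L ^ (k - j) * (L * N'))).above q)
    (hSX' : ∀ Y a j q, SX' Y a j q ⊆ (tcubeSys 4 (L ^ (k - j) * (L * N'))).above q)
    (hX0 : ∀ Y, ∀ a ∈ Sc Y, ∀ j ∈ Finset.range (k + 1), ∀ q ∈ Sq' Y a j, ∀ x ∈ SX' Y a j q,
      x.1.image (tcoarse (L ^ (k - j)) (L * N')) ⊆ Y.1)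
    -- (1) LEMMA 1: analyticity of the terms, closure of `Analytic`
    (hAdd : ∀ (s : Set Wt.Φ) (f g : Wt.Φ → ℂ), Wt.Analytic f s → Wt.Analytic g s → Wt.Analytic (f + g) s)
    (hZero : ∀ s : Set Wt.Φ, Wt.Analytic 0 s)
    (hAnT : ∀ Y, ∀ a ∈ S0 Y, ∀ X ∈ (F Y a).powerset, ∀ j ∈ Finset.range (k + 1), ∀ q ∈ Sq Y a j,
      ∀ x ∈ SX Y a j q, Wt.Analytic (T Y a X j q x) (Wt.sp1 Y))
    (hAnT' : ∀ Y, ∀ a ∈ Sc Y, ∀ j ∈ Finset.range (k + 1), ∀ q ∈ Sq' Y a j, ∀ x ∈ SX' Y a j q,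
      Wt.Analytic (T' Y a j q x) (Wt.sp1 Y))
    -- (1) LEMMA 1: thresholds and restrictions
    (hK : 0 ≤ K) (hK' : 0 ≤ K') (hκ : 0 ≤ c.κ) (hδ1 : c.δ < 1) (hδκ : 1 ≤ c.δ * c.κ)
    (hκ126 : kappa₀ 64 8 ≤ c.κ) (hκ126' : kappa₀ 64 8 ≤ c.δ * c.κ)
    (hκ₁ : 1 + 2 * Real.log (8 * 12 ^ 3) ≤ c.κ₁) (hκ₁' : 2 + 16 * Real.log 128 ≤ c.κ₁)
    (hδ₀M : 10 * Real.exp (-1) ≤ c.δ₀ * c.M) (hδ₀M5 : 2 * Real.log 5 ≤ c.δ₀ * c.M)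
    (hR8 : (1 - c.δ) * c.κ ≤ (1 / 4) * (c.κ₁ - 1)) (hR9 : (1 - 2 * c.δ) * c.κ ≤ (1 / 16) * c.κ₁)
    -- (1) LEMMA 1: per-term (1.24), (1.30) (IN-EDGES); the constants of (1.36) with headroom (1 − θ) for the local pieces
    (h124 : ∀ Y φ, φ ∈ Wt.sp1 Y → ∀ a ∈ S0 Y, ∀ X ∈ (F Y a).powerset, ∀ j ∈ Finset.range (k + 1), ∀ q ∈ Sq Y a j,
      ∀ x ∈ SX Y a j q,
        ‖T Y a X j q x φ‖ ≤ K * ((L : ℝ) ^ j * ((L : ℝ) ^ k)⁻¹) ^ 5 *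
          Real.exp (-(c.κ₁ - 1) *
            (((Y.1 \ (pbox (fun i => natLift a i - (5 : ℕ)) (fun i => natLift a i + 1 + (5 : ℕ))).image
              (proj (L * N'))).card : ℝ) + X.card)) *
          Real.exp (-(c.κ * torusTreeLen x.1)))
    (h130 : ∀ Y φ, φ ∈ Wt.sp1 Y → ∀ a ∈ Sc Y, ∀ j ∈ Finset.range (k + 1), ∀ q ∈ Sq' Y a j,
      ∀ x ∈ SX' Y a j q,
        ‖T' Y a j q x φ‖ ≤ K' * Real.exp (-(1 / 2) * (c.δ₀ * c.M) * ((L : ℝ) ^ j * ((L : ℝ) ^ k)⁻¹)⁻¹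
            - (1 / 2) * c.δ₀ * dist Y a j q) *
          Real.exp (-(c.κ₁ - 1) * ((Y.1 \ x.1.image (tcoarse (L ^ (k - j)) (L * N'))).card : ℝ)) *
          Real.exp (-(c.κ * torusTreeLen x.1)))
    {θ : ℝ} (hθ0 : 0 ≤ θ) (hθ1 : θ < 1)
    (hC : K * K₀ 64 8 * (2 * (6 * (L : ℝ)) ^ 4) * Real.exp 1 * Real.exp ((1 / 8) * c.κ₁ * (12 ^ 4 - 1)) +
        2 * (64 * K') * K₀ 64 8 * 1344 ≤
      (1 - θ) * (c.E₀ * c.ε₁ * c.C₁ * c.M ^ c.q * Real.exp (c.C₂ * c.κ₁)))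
    -- (2) LEMMA 2 (pp. 10–11): V″_k = V′_k + the local pieces G of P^{(k)}, analytic and (1.36)-small at prefactor θ
    (Gl : TDom 4 (L * N') → Wt.Φ → ℂ) (hVpp : ∀ Y, Wt.Vpp Y = fun φ => Wt.Vp Y φ + Gl Y φ)
    (hGlAn : ∀ Y, Wt.Analytic (Gl Y) (Wt.sp1 Y))
    (hGl : ∀ Y φ, φ ∈ Wt.sp1 Y → ‖Gl Y φ‖ ≤ θ * (c.E₀ * c.ε₁ * c.C₁ * c.M ^ c.q * Real.exp (c.C₂ * c.κ₁)) *
      Real.exp (-((1 - 2 * c.δ) * c.κ * (tsys 4 (L * N')).dj Y)))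
    -- (2) LEMMA 2: the located per-term data of `B13Lemma2Torus.lemma2Printed_twoTorus'`
    {E : Type*} [NormedAddCommGroup E] [NormedSpace ℂ E]
    (rd : TDom 4 (L * N') → Wt.Φ → E) (e : TDom 4 (L * N') → Wt.Bond → E) (he : ∀ Y b, ‖e Y b‖ ≤ 1)
    (hrd : ∀ Y φ, rd Y φ = haveI := Wt.finBond; ∑ b, Wt.Bv φ b • e Y b)
    {ι₂ : Type*} (s : TDom 4 (L * N') → Finset ι₂) (Wf : TDom 4 (L * N') → ι₂ → Wt.Φ → E → ℂ) {g : ℂ} (hg : g ≠ 0)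
    {R K₂ : ℝ} {m₂ : ℕ} (hK₂ : 0 ≤ K₂) (hR : 0 < R) (h3 : 3 * c.ε₁ ≤ R)
    (hW : ∀ Y, ∀ i ∈ s Y, ∀ φ ∈ Wt.sp1 Y, AnalyticOnNhd ℂ (Wf Y i φ) (ball 0 R))
    (hKW : ∀ Y, ∀ i ∈ s Y, ∀ φ ∈ Wt.sp1 Y, ∀ z ∈ ball (0 : E) R,
      ‖Wf Y i φ z‖ ≤ K₂ * Real.exp (-(c.κ₁ - 1) * ((Y.1.card : ℝ) - 1)) * ‖z‖ ^ 3)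
    (hcard : ∀ Y, (s Y).card ≤ m₂ * Y.1.card)
    (hV : ∀ Y, Wt.V Y = fun φ => (∑ i ∈ s Y, scaled g (Wf Y i φ) (rd Y φ)) + Wt.Vpp Y φ)
    (hQ : ∀ Y φ (b b' : Wt.Bond), φ ∈ Wt.sp1 Y →
      Wt.Q Y φ b b' = 2 * ∑ i ∈ s Y, Qop (scaled g (Wf Y i φ)) (rd Y φ) (e Y b) (e Y b'))
    (hsp : ∀ Y φ, φ ∈ Wt.sp1 Y → ‖g‖ * ‖rd Y φ‖ < c.ε₁)
    (hvolk : ∀ Y, Wt.volk Y = Y.1.card)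
    (hfloor : 27 * m₂ * K₂ * Real.exp (c.κ₁ - 1) ≤ c.C₃ * c.M ^ 4 * Real.exp (c.C₂ * c.κ₁))
    (hAnP : ∀ Y, ∀ i ∈ s Y, Wt.Analytic (fun φ => scaled g (Wf Y i φ) (rd Y φ)) (Wt.sp1 Y))
    (hG : ∀ Y, Wt.GaugeInv (Wt.V Y) ∧ Wt.GaugeInv (Wt.toStepData.quadForm Y) ∧ Wt.GaugeInv (Wt.Vpp Y))
    -- (3) LEMMA 3 (pp. 14–20): the signs of (2.18)–(2.20), R12, |τ(Y)| ≥ 2, and the numerics bundle at ℓ = ½L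
    (M₃ : ℕ) [NeZero M₃] {a a₂ a₂' a₅ Aabs : ℝ} (hN : Lemma3Numerics c M₃ ((c.L : ℝ) / 2) a a₂ a₂' a₅ Aabs)
    (h12 : R12 c) (hE : 0 < c.E₀) (hε : 0 < c.ε₁) (hC₁ : 0 < c.C₁) (hα : 0 < c.α₄) (hM : 1 ≤ c.M)
    (hτ2 : c.E₀ * c.ε₁ * c.C₁ * c.α₄⁻¹ * c.M ^ c.q * Real.exp (c.C₂ * c.κ₁) ≤ 1 / 2)
    -- (3) the Cauchy radius and the parameter domains (p. 15)
    -- the bigger σ-polydisc (a second constants record `cp` lending its `κ₁`; NODE A's kernels are tagged at `cp`) and a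
    -- Cauchy radius `r ≤ 1`; the τ-regions are the open discs of radii `2|τ(Y)|` (chosen inside)
    (cp : B13.Consts) (hκp : c.κ₁ < cp.κ₁) {r : ℝ} (hr : 0 < r) (hr1 : r ≤ 1)
    -- (3) THE DICTIONARY: per term (𝐃, P) of every Z ∈ 𝐃_{k+1}, the kernel data `𝒦 Z t` on a site torus `UT Nf` with
    --     configuration space `E₃`, and the configuration `u = uOf Z t φ` of `φ ∈ sp2 Z`, of size ≤ α
    {ν : ℕ} {Nf : Fin ν → ℕ} [∀ i, NeZero (Nf i)]
    {E₃ : Type*} [NormedAddCommGroup E₃] [NormedSpace ℂ E₃]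
    (𝒦 : TDom 4 N' → Finset (TDom 4 (L * N')) × Finset (TBond 4 M₃ (L * N')) → TermKernels cp 4 N' ν Nf E₃)
    [∀ Z t, Fintype (𝒦 Z t).C₀] [∀ Z t, DecidableEq (𝒦 Z t).C₀]
    (uOf : (Z : TDom 4 N') → (t : Finset (TDom 4 (L * N')) × Finset (TBond 4 M₃ (L * N'))) → Wt.Φ → E₃)
    {α : ℝ} (hαnn : 0 ≤ α) (huα : ∀ Z, ∀ t ∈ terms L M₃ Z, ∀ φ ∈ Wt.sp2 Z, ‖uOf Z t φ‖ ≤ α)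
    -- (3) per term: parameter lists, the linear map Γ(σ), characteristic functions, potentials
    (lZ : TDom 4 N' → Finset (TDom 4 (L * N')) × Finset (TBond 4 M₃ (L * N')) → List (TPt 4 N'))
    (hlZ : ∀ Z, ∀ t ∈ terms L M₃ Z, (lZ Z t).Nodup ∧ (lZ Z t).toFinset = Z.1 \ tclosure L N' (Z0 M₃ t))
    (lD : TDom 4 N' → Finset (TDom 4 (L * N')) × Finset (TBond 4 M₃ (L * N')) → List (TDom 4 (L * N')))
    (hlD : ∀ Z, ∀ t ∈ terms L M₃ Z, (lD Z t).Nodup ∧ (lD Z t).toFinset = t.1)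
    (Γm : (Z : TDom 4 N') → (t : Finset (TDom 4 (L * N')) × Finset (TBond 4 M₃ (L * N'))) → Wt.Φ →
      (TPt 4 N' → ℂ) → ((𝒦 Z t).Λ ⊕ (𝒦 Z t).C₀ → ℝ) → ((𝒦 Z t).Λ → ℂ))
    (χY₀ χcP : (Z : TDom 4 N') → (t : Finset (TDom 4 (L * N')) × Finset (TBond 4 M₃ (L * N'))) →
      ((𝒦 Z t).Λ → ℝ) → ℝ)
    (hχ0 : ∀ Z t B, 0 ≤ χY₀ Z t B) (hχ1 : ∀ Z t B, χY₀ Z t B ≤ 1)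
    (Pl : (Z : TDom 4 N') → (t : Finset (TDom 4 (L * N')) × Finset (TBond 4 M₃ (L * N'))) → Finset (𝒦 Z t).Λ)
    (hPcard : ∀ Z, ∀ t ∈ terms L M₃ Z, (Pl Z t).card = t.2.card) {rP : ℝ} (hrP : 0 ≤ rP)
    (hχc : ∀ Z t B, χcP Z t B = ∏ b ∈ Pl Z t, (if rP ≤ |B b| then (1 : ℝ) else 0))
    (Dfam : TDom 4 N' → Finset (TDom 4 (L * N')) × Finset (TBond 4 M₃ (L * N')) → Finset (TDom 4 (L * N')))
    (Vr : (Z : TDom 4 N') → (t : Finset (TDom 4 (L * N')) × Finset (TBond 4 M₃ (L * N'))) → Wt.Φ →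
      TDom 4 (L * N') → ((𝒦 Z t).Λ → ℝ) → ℂ)
    -- (3) termwise domination: ‖H(Z)‖ ≤ Σ_{(𝐃,P)} ‖(2.14)‖ on the space of p. 15 ((2.9)/(2.14))
    (hH : ∀ (Z : TDom 4 N') (φ : Wt.Φ), φ ∈ Wt.sp2 Z → ‖Wt.H Z φ‖ ≤
      ∑ t ∈ terms L M₃ Z, ‖term214 r (lZ Z t) (lD Z t)
        (core214 (fun σ => (𝒦 Z t).A2 σ (uOf Z t φ)) (Γm Z t φ)
          (F214 t.2.card (χY₀ Z t) (χcP Z t) (Dfam Z t) (Vr Z t φ))) 0 0‖)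
    -- (3) the record's objects behind the terms: bonds, cubes, the real field inside the configurations
    (ιb : (Z : TDom 4 N') → (t : Finset (TDom 4 (L * N')) × Finset (TBond 4 M₃ (L * N'))) → (𝒦 Z t).Λ → Wt.Bond)
    (hι : ∀ Z t, Function.Injective (ιb Z t)) (cube : Wt.Bond → TPt 4 (L * N'))
    (hQsupp : ∀ (Y : TDom 4 (L * N')) φ b b', Wt.Q Y φ b b' ≠ 0 → cube b ∈ Y.1 ∧ cube b' ∈ Y.1)
    {m' : ℕ} (hfibc : ∀ Z t (x : TPt 4 (L * N')), (Finset.univ.filter fun j => cube (ιb Z t j) = x).card ≤ m')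
    (emb : (Z : TDom 4 N') → (t : Finset (TDom 4 (L * N')) × Finset (TBond 4 M₃ (L * N'))) → Wt.Φ →
      ((𝒦 Z t).Λ → ℝ) → Wt.Φ)
    (hBv : ∀ Z t φ B b, Wt.Bv (emb Z t φ B) (ιb Z t b) = (B b : ℂ))
    (hBv0 : ∀ Z t φ B b', b' ∉ Set.range (ιb Z t) → Wt.Bv (emb Z t φ B) b' = 0)
    (hVr : ∀ Z, ∀ t ∈ terms L M₃ Z, ∀ φ ∈ Wt.sp2 Z, ∀ Y ∈ Dfam Z t, ∀ B,
      emb Z t φ B ∈ Wt.sp1 Y → Vr Z t φ Y B = Wt.V Y (emb Z t φ B))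
    (hχsupp : ∀ Z, ∀ t ∈ terms L M₃ Z, ∀ φ ∈ Wt.sp2 Z, ∀ B, χY₀ Z t B ≠ 0 → ∀ Y ∈ Dfam Z t,
      emb Z t φ B ∈ Wt.sp1 Y)
    -- (3) REPLACES the separate holomorphy `hΨσ ∕ hΨτ` of the X-integral: NODE A's kernels `A(σ,u)`, `G(σ,u)` entrywise
    --     HOLOMORPHIC IN σ on the open `e^{κ₁⁺}`-polydisc at the configuration (print p. 15: analytic functions of σ(Z)),
    --     and measurability of the record's `χ_{k,Y₀}`, potentials, small-field region in the bond variables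
    (hAhol : ∀ Z, ∀ t ∈ terms L M₃ Z, ∀ φ ∈ Wt.sp2 Z, ∀ i j, DifferentiableOn ℂ (fun σ => (𝒦 Z t).A2 σ (uOf Z t φ) i j)
      {σ : TPt 4 N' → ℂ | ∀ j, σ j ∈ Metric.ball (0 : ℂ) (Real.exp cp.κ₁)})
    (hGhol : ∀ Z, ∀ t ∈ terms L M₃ Z, ∀ φ ∈ Wt.sp2 Z, ∀ i j, DifferentiableOn ℂ (fun σ => (𝒦 Z t).G2 σ (uOf Z t φ) i j)
      {σ : TPt 4 N' → ℂ | ∀ j, σ j ∈ Metric.ball (0 : ℂ) (Real.exp cp.κ₁)})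
    (hχm : ∀ Z t, Measurable (χY₀ Z t)) (hVm : ∀ Z t φ Y, Measurable (Vr Z t φ Y))
    (hsmallm : ∀ Z t φ, MeasurableSet {B : (𝒦 Z t).Λ → ℝ | ∀ Y ∈ Dfam Z t, emb Z t φ B ∈ Wt.sp1 Y})
    -- (3) NODE A's structural inputs at the configuration: A(σ) COMPLEX SYMMETRIC on the polydisc; Γ(σ) = G(σ)·
    --     (`Re A(σ) ≻ 0` is no longer asked: it follows from the rung's m_A-accretivity, `re_posDef_of_termWalks`)
    (hAs : ∀ Z, ∀ t ∈ terms L M₃ Z, ∀ φ ∈ Wt.sp2 Z, ∀ σ : TPt 4 N' → ℂ, (∀ j, ‖σ j‖ ≤ Real.exp cp.κ₁) →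
      ((𝒦 Z t).A2 σ (uOf Z t φ)).IsSymm)
    (hlin : ∀ Z, ∀ t ∈ terms L M₃ Z, ∀ φ ∈ Wt.sp2 Z, ∀ σ : TPt 4 N' → ℂ, (∀ j, ‖σ j‖ ≤ Real.exp cp.κ₁) →
      ∀ X : (𝒦 Z t).Λ ⊕ (𝒦 Z t).C₀ → ℝ, Γm Z t φ σ X = (𝒦 Z t).G2 σ (uOf Z t φ) *ᵥ fun j => (X j : ℂ))
    {γ₂ : ℝ} (hγ₂ : 0 ≤ γ₂)
    -- (3) uniform fibre bounds of the bond locations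
    {m : ℕ}
    (hfibΛ : ∀ Z t (x : UT Nf), (Finset.univ.filter fun i => (𝒦 Z t).locΛ i = x).card ≤ m)
    (hfibN : ∀ Z t (x : UT Nf), (Finset.univ.filter fun j => (𝒦 Z t).locN j = x).card ≤ m)
    -- (3) THE REFERENCE RUNG ON THE TERMS OF THE STEP (the displayed hypothesis, n10-b's reference currency): ONE
    --     admissible reference package `r`, an accretivity radius `0 < R₁ < R`, print's two perturbative sources (p. 15:
    --     «O(1)e^{−⅓δ₀M} + O(α₀ + α₁)» against the reference positivity) as FOUR DIVISION-FREE THRESHOLDS, positive input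
    --     rates and `η ≤ etaMax` of the W-walks package `rf.toWalkPackage R₁`, a rate book for it, `TermWalksRef` per term
    (rf : RefPackage) (hrf : rf.Admissible) {R₁ : ℝ} (hR₁ : 0 < R₁) (hR₁R : R₁ < rf.R)
    (hPσ : 8 * rf.KbarP * rf.cV₀ * Real.exp (-(rf.εP * rf.Rσ)) ≤ rf.m₀) (hP₁ : 8 * rf.KbarP * rf.cV₀ * R₁ ≤ rf.m₀ * rf.R)
    (hAσ : 8 * rf.KbarA * rf.cV * Real.exp (-(rf.εA * rf.Rσ)) ≤ rf.mA₀) (hA₁ : 8 * rf.KbarA * rf.cV * R₁ ≤ rf.mA₀ * rf.R)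
    (hp : (rf.toWalkPackage R₁).PositiveRates) (hη : rf.η ≤ (rf.toWalkPackage R₁).etaMax)
    (rb : RateBook (rf.toWalkPackage R₁)) (hκC : 0 < rb.κC) (hκCρ : rb.κC ≤ rb.ρ') (hαR : α < R₁)
    (hwalks : ∀ Z, ∀ t ∈ terms L M₃ Z, TermWalksRef (𝒦 Z t) rf)
    {KG KCs θ₀ : ℝ} (hKG : (rf.toWalkPackage R₁).Kbar ≤ KG) (hKCs : 8 / rf.mA₀ ≤ KCs)
    (hθ : 2 * (rf.toWalkPackage R₁).Kbar * (Real.exp (-((rb.ρ' - rb.κC) * rf.Rσ)) + α / R₁) ≤ θ₀)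
    -- (3) rates below the rate book's κ_C, and NODE A's letter ϑ (θ_Γ = θ_E = θ₀, K_Γ = K_G, K₀′ = K_Cs, θ_C derived)
    {kap kap' kap'' kap₂ ϑ : ℝ} (hkap'' : 0 < kap'') (hk1 : kap'' < kap') (hk2 : kap' < kap) (hk3 : kap < kap₂)
    (hk4 : kap₂ < rb.κC) (hθ₀le : θ₀ ≤ ϑ)
    (hθR1le : (m * (1 + 2 / (kap - kap')) ^ ν) * (m * (1 + 2 / (kap' - kap'')) ^ ν)
      * (θ₀ * KCs * KG
        + KG * (KCs * θ₀ * (m * (1 + 2 / (rb.κC - kap₂)) ^ ν) * KCs * (m * (1 + 2 / (kap₂ - kap)) ^ ν)) * KG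
        + KG * KCs * θ₀) ≤ ϑ)
    (hsmallKθ : KCs * (m * (1 + 2 / kap) ^ ν) * (ϑ * (m * (1 + 2 / kap'') ^ ν)) < 1)
    -- (3) the (2.24)–(2.25) smallness with `a₂₀ = 2·m′·α₄·M⁻⁴(1 + 32/(κ₁−1))⁴`; the eigenvalue bound of C is the NUMBER
    --     `2∕m_{A,0} ≤ cE`; the form bound of Γ₀ is the NUMBER `g = B_Γ²c_V·m c₀(1,η)^ν∕(m_{A,0}∕2)`
    {cE : ℝ} (hc0 : 0 ≤ cE)
    (hcE : 2 / rf.mA₀ ≤ cE)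
    (hαc : (2 * (ϑ * (m * (1 + 2 / kap'') ^ ν)) +
      (γ₂ + 2 * (m' * c.α₄ * (c.M ^ 4)⁻¹ * (1 + 32 / (c.κ₁ - 1)) ^ 4))) * cE ≤ 1 / 2)
    (hsmall : (2 * (ϑ * (m * (1 + 2 / kap'') ^ ν)) +
      (γ₂ + 2 * (m' * c.α₄ * (c.M ^ 4)⁻¹ * (1 + 32 / (c.κ₁ - 1)) ^ 4))) * (1 + 2 * cE * (((rf.toWalkPackage R₁).BΓ * rf.cV) * ((rf.toWalkPackage R₁).BΓ * (m * B6.c0 1 rf.η ^ ν)) / (rf.mA₀ / 2))) ≤ 1 / 2)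
    -- (3) constant matching, p. 17: `a ≤ γ₂ r_P²` and the volume factor with `w = 2·K₀(64,8)·α₄·#(⋃𝐃)`
    (hPa : a ≤ γ₂ * rP ^ 2)
    (hvol : ∀ Z, ∀ t ∈ terms L M₃ Z,
      2 * (KCs * (m * (1 + 2 / kap) ^ ν) * (ϑ * (m * (1 + 2 / kap'') ^ ν))
              * (1 + (1 - KCs * (m * (1 + 2 / kap) ^ ν) * (ϑ * (m * (1 + 2 / kap'') ^ ν)))⁻¹) / 2)
          * (Fintype.card (𝒦 Z t).Λ : ℝ)
        + 2 * (K₀ 64 8 * c.α₄ * ((((Dfam Z t).image Subtype.val).biUnion id).card : ℝ))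
        + (2 * (ϑ * (m * (1 + 2 / kap'') ^ ν)) +
            (γ₂ + 2 * (m' * c.α₄ * (c.M ^ 4)⁻¹ * (1 + 32 / (c.κ₁ - 1)) ^ 4))) * cE * (Fintype.card (𝒦 Z t).Λ : ℝ)
        + (2 * (ϑ * (m * (1 + 2 / kap'') ^ ν)) +
            (γ₂ + 2 * (m' * c.α₄ * (c.M ^ 4)⁻¹ * (1 + 32 / (c.κ₁ - 1)) ^ 4))) * (1 + 2 * cE * (((rf.toWalkPackage R₁).BΓ * rf.cV) * ((rf.toWalkPackage R₁).BΓ * (m * B6.c0 1 rf.η ^ ν)) / (rf.mA₀ / 2)))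
            * (Fintype.card ((𝒦 Z t).Λ ⊕ (𝒦 Z t).C₀) : ℝ)
        ≤ a₅ * ((Z.1).card : ℝ)) :
    B13.Lemma1Printed Wt.toStepData c ∧ B13.Lemma2Printed Wt.toStepData c ∧ B13.Lemma3Printed Wt.toStepData c := by
  have hmA2 : (rf.toWalkPackage R₁).mA = rf.mA₀ / 2 := rfl
  have hKCs' : 4 / (rf.toWalkPackage R₁).mA ≤ KCs := by
    rw [hmA2, div_div_eq_mul_div]; norm_num; exact hKCs
  have hcE' : 1 / (rf.toWalkPackage R₁).mA ≤ cE := by rw [hmA2, one_div_div]; exact hcE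
  exact b13Leaf_twoTorus_walksHolo Wt c k hN12 hL8 hLc S0 F Sq SX T Sc Sq' SX' T' dist h133 hS0Y hFsub hSq hScY hdist0 hdist
    hSX hSX' hX0 hAdd hZero hAnT hAnT' hK hK' hκ hδ1 hδκ hκ126 hκ126' hκ₁ hκ₁' hδ₀M hδ₀M5 hR8 hR9 h124 h130 hθ0 hθ1 hC
    Gl hVpp hGlAn hGl rd e he hrd s Wf hg hK₂ hR h3 hW hKW hcard hV hQ hsp hvolk hfloor hAnP hG M₃ hN h12 hE hε hC₁ hα
    hM hτ2 cp hκp hr hr1 𝒦 uOf hαnn huα lZ hlZ lD hlD Γm χY₀ χcP hχ0 hχ1 Pl hPcard hrP hχc Dfam Vr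
    hH ιb hι cube hQsupp hfibc emb hBv hBv0 hVr hχsupp hAhol hGhol hχm hVm hsmallm hAs hlin hγ₂ hfibΛ hfibN (rf.toWalkPackage R₁)
    (RefPackage.admissible_toWalkPackage hrf hR₁) hp hη hrf.hη rb hκC hκCρ hαR
    (fun Z t ht => termWalks_of_ref_thresholds hrf (hwalks Z t ht) hR₁ hR₁R hPσ hP₁ hAσ hA₁)
    hKG hKCs' hθ hkap'' hk1 hk2 hk3 hk4 hθ₀le hθR1le hsmallKθ hc0 hcE' hαc hsmall hPa hvol

end Ref

/-! ## §3. The FAN-OUT s3 shape keyed by `UniformWalksAcrossRef 𝓣 rf`, `hΨσ ∕ hΨτ` derived -/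

section Across

variable {L : ℕ} [NeZero L]

open Matrix

/-- **A member's term of a family carrying the REFERENCE rung carries `TermWalksRef` — at ANY instances of its extra columns**
(the `Fintype`∕`DecidableEq` structures of `C₀` are `∃`-binders of `UniformWalksAcrossRef`; both are subsingletons, so the datum transports;
twin of `B13NodeTorusWalks.termWalks_of_uniformWalksAcross`). [cite: Balaban1988RG2Cluster, p.13, p.15] -/
theorem termWalksRef_of_uniformWalksAcrossRef {cp : B13.Consts} {S : Type*} {𝓣 : S → TorusTerms cp 4} {rf : RefPackage}
    (hall : UniformWalksAcrossRef 𝓣 rf) (s : S) (i : (𝓣 s).ι)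
    [hF : Fintype ((𝓣 s).𝒦 i).C₀] [hD : DecidableEq ((𝓣 s).𝒦 i).C₀] : TermWalksRef ((𝓣 s).𝒦 i) rf := by
  obtain ⟨hF', hD', hw⟩ := hall s i
  have h1 : hF' = hF := Subsingleton.elim _ _
  have h2 : hD' = hD := Subsingleton.elim _ _
  subst h1 h2
  exact hw

open Classical in
/-- **N10's LEAF TRIPLE FROM THE DISPLAYED HYPOTHESIS `UniformWalksAcrossRef 𝓣 rf`, WITHOUT `hΨσ ∕ hΨτ`** — the FAN-OUT §N10 s3 shape in
the reference currency with the regularity letters derived.  Exactly `B13NodeTorusWalksRefLeaves.b13Leaf_twoTorus_uniformWalksAcrossRef`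
(p467638; same binders in the same order, same conclusion) except the module header's trade, the family being tagged at the bigger
polydisc's constants record: `(c cp : B13.Consts) (𝓣 : S → TorusTerms cp 4)`, `(hκp : c.κ₁ < cp.κ₁) {r} (hr) (hr1 : r ≤ 1)` in place of
the region binders, per-term `hAhol hGhol hχm hVm hsmallm` in place of `hΨσ hΨτ`, `hAs hlin` on the closed `e^{cp.κ₁}`-polydisc, `a₂₀`, `w`
DOUBLED.  Proof: `b13Leaf_twoTorus_walksRefHolo` at the member's kernels `(𝓣 s₀).𝒦 (idx Z t)` with the standard rate book and print's two
thresholds (`exchange_of_thresholds`), the rung per term by `termWalksRef_of_uniformWalksAcrossRef`.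
[cite: Balaban1988RG2Cluster, Lemmas 1–3 pp.9, 11, 20; (1.11) p.5, p.13, p.15, (2.14)–(2.26) pp.15–17; Balaban1985BackgroundPropagators, Thm 3.10 p.416, Thm 3.12 p.423] -/
theorem b13Leaf_twoTorus_uniformWalksAcrossRefHolo
    (c cp : B13.Consts) {S : Type*} (𝓣 : S → TorusTerms cp 4) {rf : RefPackage} (hall : UniformWalksAcrossRef 𝓣 rf)
    (s₀ : S) [NeZero (𝓣 s₀).N'] (Wt : TwoTorusStep 4 L (𝓣 s₀).N') (k : ℕ) (hN12 : 12 ≤ L * (𝓣 s₀).N') (hL8 : 8 ≤ c.L) (hLc : c.L = L)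
    -- (1) LEMMA 1: index data of (1.33)
    (S0 : TDom 4 (L * (𝓣 s₀).N') → Finset (TPt 4 (L * (𝓣 s₀).N')))
    (F : TDom 4 (L * (𝓣 s₀).N') → TPt 4 (L * (𝓣 s₀).N') → Finset (TPt 4 (L * (𝓣 s₀).N')))
    (Sq : TDom 4 (L * (𝓣 s₀).N') → TPt 4 (L * (𝓣 s₀).N') → (j : ℕ) → Finset (TPt 4 (L ^ (k - j) * (L * (𝓣 s₀).N'))))
    (SX : TDom 4 (L * (𝓣 s₀).N') → TPt 4 (L * (𝓣 s₀).N') → (j : ℕ) → TPt 4 (L ^ (k - j) * (L * (𝓣 s₀).N')) →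
      Finset (TDom 4 (L ^ (k - j) * (L * (𝓣 s₀).N'))))
    (T : TDom 4 (L * (𝓣 s₀).N') → TPt 4 (L * (𝓣 s₀).N') → Finset (TPt 4 (L * (𝓣 s₀).N')) → (j : ℕ) →
      TPt 4 (L ^ (k - j) * (L * (𝓣 s₀).N')) → TDom 4 (L ^ (k - j) * (L * (𝓣 s₀).N')) → Wt.Φ → ℂ)
    (Sc : TDom 4 (L * (𝓣 s₀).N') → Finset (TPt 4 (L * (𝓣 s₀).N')))
    (Sq' : TDom 4 (L * (𝓣 s₀).N') → TPt 4 (L * (𝓣 s₀).N') → (j : ℕ) → Finset (TPt 4 (L ^ (k - j) * (L * (𝓣 s₀).N'))))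
    (SX' : TDom 4 (L * (𝓣 s₀).N') → TPt 4 (L * (𝓣 s₀).N') → (j : ℕ) → TPt 4 (L ^ (k - j) * (L * (𝓣 s₀).N')) →
      Finset (TDom 4 (L ^ (k - j) * (L * (𝓣 s₀).N'))))
    (T' : TDom 4 (L * (𝓣 s₀).N') → TPt 4 (L * (𝓣 s₀).N') → (j : ℕ) → TPt 4 (L ^ (k - j) * (L * (𝓣 s₀).N')) →
      TDom 4 (L ^ (k - j) * (L * (𝓣 s₀).N')) → Wt.Φ → ℂ)
    (dist : TDom 4 (L * (𝓣 s₀).N') → TPt 4 (L * (𝓣 s₀).N') → (j : ℕ) → TPt 4 (L ^ (k - j) * (L * (𝓣 s₀).N')) → ℝ) {K K' : ℝ}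
    (h133 : ∀ Y, Wt.Vp Y =
      (∑ a ∈ S0 Y, ∑ X ∈ (F Y a).powerset, ∑ j ∈ Finset.range (k + 1), ∑ q ∈ Sq Y a j,
        ∑ x ∈ SX Y a j q, T Y a X j q x) +
      (∑ a ∈ Sc Y, ∑ j ∈ Finset.range (k + 1), ∑ q ∈ Sq' Y a j, ∑ x ∈ SX' Y a j q, T' Y a j q x))
    (hS0Y : ∀ Y, ∀ a ∈ S0 Y,
      (pbox (fun i => natLift a i - (5 : ℕ)) (fun i => natLift a i + 1 + (5 : ℕ))).image (proj (L * (𝓣 s₀).N')) ⊆ Y.1)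
    (hFsub : ∀ Y a, F Y a ⊆
      (pbox (fun i => natLift a i - (5 : ℕ)) (fun i => natLift a i + 1 + (5 : ℕ))).image (proj (L * (𝓣 s₀).N')) \
        (pbox (fun i => natLift a i - (4 : ℕ)) (fun i => natLift a i + 1 + (4 : ℕ))).image (proj (L * (𝓣 s₀).N')))
    (hSq : ∀ Y, ∀ a ∈ S0 Y, ∀ j, Sq Y a j ⊆ (Finset.univ : Finset (TPt 4 (L ^ (k - j) * (L * (𝓣 s₀).N')))).filter
      (fun q => tcoarse (L ^ (k - j)) (L * (𝓣 s₀).N') q ∈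
        (pbox (fun i => natLift a i - (2 : ℕ)) (fun i => natLift a i + 1 + (2 : ℕ))).image (proj (L * (𝓣 s₀).N'))))
    (hScY : ∀ Y, Sc Y ⊆ Y.1)
    (hdist0 : ∀ Y a j q, 0 ≤ c.δ₀ * dist Y a j q)
    (hdist : ∀ Y a j (n : ℕ) q, q ∉ (pbox (fun i => ((L ^ (k - j) : ℕ) : ℤ) * natLift a i - (n + 1 : ℕ))
      (fun i => ((L ^ (k - j) : ℕ) : ℤ) * natLift a i + 2 * ((L ^ (k - j) : ℕ) : ℤ) - 1 + (n + 1 : ℕ))).image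
        (proj (L ^ (k - j) * (L * (𝓣 s₀).N'))) → c.δ₀ * c.M * ((n : ℝ) + 1) ≤ c.δ₀ * dist Y a j q)
    (hSX : ∀ Y a j q, SX Y a j q ⊆ (tcubeSys 4 (L ^ (k - j) * (L * (𝓣 s₀).N'))).above q)
    (hSX' : ∀ Y a j q, SX' Y a j q ⊆ (tcubeSys 4 (L ^ (k - j) * (L * (𝓣 s₀).N'))).above q)
    (hX0 : ∀ Y, ∀ a ∈ Sc Y, ∀ j ∈ Finset.range (k + 1), ∀ q ∈ Sq' Y a j, ∀ x ∈ SX' Y a j q,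
      x.1.image (tcoarse (L ^ (k - j)) (L * (𝓣 s₀).N')) ⊆ Y.1)
    -- (1) LEMMA 1: analyticity of the terms, closure of `Analytic`
    (hAdd : ∀ (s : Set Wt.Φ) (f g : Wt.Φ → ℂ), Wt.Analytic f s → Wt.Analytic g s → Wt.Analytic (f + g) s)
    (hZero : ∀ s : Set Wt.Φ, Wt.Analytic 0 s)
    (hAnT : ∀ Y, ∀ a ∈ S0 Y, ∀ X ∈ (F Y a).powerset, ∀ j ∈ Finset.range (k + 1), ∀ q ∈ Sq Y a j,
      ∀ x ∈ SX Y a j q, Wt.Analytic (T Y a X j q x) (Wt.sp1 Y))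
    (hAnT' : ∀ Y, ∀ a ∈ Sc Y, ∀ j ∈ Finset.range (k + 1), ∀ q ∈ Sq' Y a j, ∀ x ∈ SX' Y a j q,
      Wt.Analytic (T' Y a j q x) (Wt.sp1 Y))
    -- (1) LEMMA 1: thresholds and restrictions
    (hK : 0 ≤ K) (hK' : 0 ≤ K') (hκ : 0 ≤ c.κ) (hδ1 : c.δ < 1) (hδκ : 1 ≤ c.δ * c.κ)
    (hκ126 : kappa₀ 64 8 ≤ c.κ) (hκ126' : kappa₀ 64 8 ≤ c.δ * c.κ)
    (hκ₁ : 1 + 2 * Real.log (8 * 12 ^ 3) ≤ c.κ₁) (hκ₁' : 2 + 16 * Real.log 128 ≤ c.κ₁)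
    (hδ₀M : 10 * Real.exp (-1) ≤ c.δ₀ * c.M) (hδ₀M5 : 2 * Real.log 5 ≤ c.δ₀ * c.M)
    (hR8 : (1 - c.δ) * c.κ ≤ (1 / 4) * (c.κ₁ - 1)) (hR9 : (1 - 2 * c.δ) * c.κ ≤ (1 / 16) * c.κ₁)
    -- (1) LEMMA 1: per-term (1.24), (1.30) (IN-EDGES); the constants of (1.36) with headroom (1 − θ) for the local pieces
    (h124 : ∀ Y φ, φ ∈ Wt.sp1 Y → ∀ a ∈ S0 Y, ∀ X ∈ (F Y a).powerset, ∀ j ∈ Finset.range (k + 1), ∀ q ∈ Sq Y a j,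
      ∀ x ∈ SX Y a j q,
        ‖T Y a X j q x φ‖ ≤ K * ((L : ℝ) ^ j * ((L : ℝ) ^ k)⁻¹) ^ 5 *
          Real.exp (-(c.κ₁ - 1) *
            (((Y.1 \ (pbox (fun i => natLift a i - (5 : ℕ)) (fun i => natLift a i + 1 + (5 : ℕ))).image
              (proj (L * (𝓣 s₀).N'))).card : ℝ) + X.card)) *
          Real.exp (-(c.κ * torusTreeLen x.1)))
    (h130 : ∀ Y φ, φ ∈ Wt.sp1 Y → ∀ a ∈ Sc Y, ∀ j ∈ Finset.range (k + 1), ∀ q ∈ Sq' Y a j,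
      ∀ x ∈ SX' Y a j q,
        ‖T' Y a j q x φ‖ ≤ K' * Real.exp (-(1 / 2) * (c.δ₀ * c.M) * ((L : ℝ) ^ j * ((L : ℝ) ^ k)⁻¹)⁻¹
            - (1 / 2) * c.δ₀ * dist Y a j q) *
          Real.exp (-(c.κ₁ - 1) * ((Y.1 \ x.1.image (tcoarse (L ^ (k - j)) (L * (𝓣 s₀).N'))).card : ℝ)) *
          Real.exp (-(c.κ * torusTreeLen x.1)))
    {θ : ℝ} (hθ0 : 0 ≤ θ) (hθ1 : θ < 1)
    (hC : K * K₀ 64 8 * (2 * (6 * (L : ℝ)) ^ 4) * Real.exp 1 * Real.exp ((1 / 8) * c.κ₁ * (12 ^ 4 - 1)) +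
        2 * (64 * K') * K₀ 64 8 * 1344 ≤
      (1 - θ) * (c.E₀ * c.ε₁ * c.C₁ * c.M ^ c.q * Real.exp (c.C₂ * c.κ₁)))
    -- (2) LEMMA 2 (pp. 10–11): V″_k = V′_k + the local pieces G of P^{(k)}, analytic and (1.36)-small at prefactor θ
    (Gl : TDom 4 (L * (𝓣 s₀).N') → Wt.Φ → ℂ) (hVpp : ∀ Y, Wt.Vpp Y = fun φ => Wt.Vp Y φ + Gl Y φ)
    (hGlAn : ∀ Y, Wt.Analytic (Gl Y) (Wt.sp1 Y))
    (hGl : ∀ Y φ, φ ∈ Wt.sp1 Y → ‖Gl Y φ‖ ≤ θ * (c.E₀ * c.ε₁ * c.C₁ * c.M ^ c.q * Real.exp (c.C₂ * c.κ₁)) *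
      Real.exp (-((1 - 2 * c.δ) * c.κ * (tsys 4 (L * (𝓣 s₀).N')).dj Y)))
    -- (2) LEMMA 2: the located per-term data of `B13Lemma2Torus.lemma2Printed_twoTorus'`
    {E : Type*} [NormedAddCommGroup E] [NormedSpace ℂ E]
    (rd : TDom 4 (L * (𝓣 s₀).N') → Wt.Φ → E) (e : TDom 4 (L * (𝓣 s₀).N') → Wt.Bond → E) (he : ∀ Y b, ‖e Y b‖ ≤ 1)
    (hrd : ∀ Y φ, rd Y φ = haveI := Wt.finBond; ∑ b, Wt.Bv φ b • e Y b)
    {ι₂ : Type*} (s : TDom 4 (L * (𝓣 s₀).N') → Finset ι₂) (Wf : TDom 4 (L * (𝓣 s₀).N') → ι₂ → Wt.Φ → E → ℂ) {g : ℂ} (hg : g ≠ 0)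
    {R K₂ : ℝ} {m₂ : ℕ} (hK₂ : 0 ≤ K₂) (hR : 0 < R) (h3 : 3 * c.ε₁ ≤ R)
    (hW : ∀ Y, ∀ i ∈ s Y, ∀ φ ∈ Wt.sp1 Y, AnalyticOnNhd ℂ (Wf Y i φ) (ball 0 R))
    (hKW : ∀ Y, ∀ i ∈ s Y, ∀ φ ∈ Wt.sp1 Y, ∀ z ∈ ball (0 : E) R,
      ‖Wf Y i φ z‖ ≤ K₂ * Real.exp (-(c.κ₁ - 1) * ((Y.1.card : ℝ) - 1)) * ‖z‖ ^ 3)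
    (hcard : ∀ Y, (s Y).card ≤ m₂ * Y.1.card)
    (hV : ∀ Y, Wt.V Y = fun φ => (∑ i ∈ s Y, scaled g (Wf Y i φ) (rd Y φ)) + Wt.Vpp Y φ)
    (hQ : ∀ Y φ (b b' : Wt.Bond), φ ∈ Wt.sp1 Y →
      Wt.Q Y φ b b' = 2 * ∑ i ∈ s Y, Qop (scaled g (Wf Y i φ)) (rd Y φ) (e Y b) (e Y b'))
    (hsp : ∀ Y φ, φ ∈ Wt.sp1 Y → ‖g‖ * ‖rd Y φ‖ < c.ε₁)
    (hvolk : ∀ Y, Wt.volk Y = Y.1.card)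
    (hfloor : 27 * m₂ * K₂ * Real.exp (c.κ₁ - 1) ≤ c.C₃ * c.M ^ 4 * Real.exp (c.C₂ * c.κ₁))
    (hAnP : ∀ Y, ∀ i ∈ s Y, Wt.Analytic (fun φ => scaled g (Wf Y i φ) (rd Y φ)) (Wt.sp1 Y))
    (hG : ∀ Y, Wt.GaugeInv (Wt.V Y) ∧ Wt.GaugeInv (Wt.toStepData.quadForm Y) ∧ Wt.GaugeInv (Wt.Vpp Y))
    -- (3) LEMMA 3 (pp. 14–20): the signs of (2.18)–(2.20), R12, |τ(Y)| ≥ 2, and the numerics bundle at ℓ = ½L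
    (M₃ : ℕ) [NeZero M₃] {a a₂ a₂' a₅ Aabs : ℝ} (hN : Lemma3Numerics c M₃ ((c.L : ℝ) / 2) a a₂ a₂' a₅ Aabs)
    (h12 : R12 c) (hE : 0 < c.E₀) (hε : 0 < c.ε₁) (hC₁ : 0 < c.C₁) (hα : 0 < c.α₄) (hM : 1 ≤ c.M)
    (hτ2 : c.E₀ * c.ε₁ * c.C₁ * c.α₄⁻¹ * c.M ^ c.q * Real.exp (c.C₂ * c.κ₁) ≤ 1 / 2)
    -- (3) the Cauchy radius and the parameter domains (p. 15)
    -- the bigger σ-polydisc is `cp`'s (the family is tagged at `cp`, `c.κ₁ < cp.κ₁`) and a Cauchy radius `r ≤ 1`; the τ-regions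
    -- are the open discs of radii `2|τ(Y)|` (chosen inside)
    (hκp : c.κ₁ < cp.κ₁) {r : ℝ} (hr : 0 < r) (hr1 : r ≤ 1)
    -- (3) THE DICTIONARY: the (2.14)-term (𝐃, P) = t of Z ∈ 𝐃_{k+1} is the term `idx Z t` of the member `s₀` (its
    --     extra columns finite), read at the configuration `u = uOf Z t φ ∈ (𝓣 s₀).E` of `φ ∈ sp2 Z`, of size ≤ α
    (idx : TDom 4 (𝓣 s₀).N' → Finset (TDom 4 (L * (𝓣 s₀).N')) × Finset (TBond 4 M₃ (L * (𝓣 s₀).N')) → (𝓣 s₀).ι)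
    [∀ Z t, Fintype ((𝓣 s₀).𝒦 (idx Z t)).C₀] [∀ Z t, DecidableEq ((𝓣 s₀).𝒦 (idx Z t)).C₀]
    (uOf : (Z : TDom 4 (𝓣 s₀).N') → (t : Finset (TDom 4 (L * (𝓣 s₀).N')) × Finset (TBond 4 M₃ (L * (𝓣 s₀).N'))) →
      Wt.Φ → (𝓣 s₀).E)
    {α : ℝ} (hαnn : 0 ≤ α) (huα : ∀ Z, ∀ t ∈ terms L M₃ Z, ∀ φ ∈ Wt.sp2 Z, ‖uOf Z t φ‖ ≤ α)
    -- (3) per term: parameter lists, the linear map Γ(σ), characteristic functions, potentials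
    (lZ : TDom 4 (𝓣 s₀).N' → Finset (TDom 4 (L * (𝓣 s₀).N')) × Finset (TBond 4 M₃ (L * (𝓣 s₀).N')) →
      List (TPt 4 (𝓣 s₀).N'))
    (hlZ : ∀ Z, ∀ t ∈ terms L M₃ Z, (lZ Z t).Nodup ∧ (lZ Z t).toFinset = Z.1 \ tclosure L (𝓣 s₀).N' (Z0 M₃ t))
    (lD : TDom 4 (𝓣 s₀).N' → Finset (TDom 4 (L * (𝓣 s₀).N')) × Finset (TBond 4 M₃ (L * (𝓣 s₀).N')) →
      List (TDom 4 (L * (𝓣 s₀).N')))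
    (hlD : ∀ Z, ∀ t ∈ terms L M₃ Z, (lD Z t).Nodup ∧ (lD Z t).toFinset = t.1)
    (Γm : (Z : TDom 4 (𝓣 s₀).N') → (t : Finset (TDom 4 (L * (𝓣 s₀).N')) × Finset (TBond 4 M₃ (L * (𝓣 s₀).N'))) → Wt.Φ →
      (TPt 4 (𝓣 s₀).N' → ℂ) → (((𝓣 s₀).𝒦 (idx Z t)).Λ ⊕ ((𝓣 s₀).𝒦 (idx Z t)).C₀ → ℝ) → (((𝓣 s₀).𝒦 (idx Z t)).Λ → ℂ))
    (χY₀ χcP : (Z : TDom 4 (𝓣 s₀).N') → (t : Finset (TDom 4 (L * (𝓣 s₀).N')) × Finset (TBond 4 M₃ (L * (𝓣 s₀).N'))) →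
      (((𝓣 s₀).𝒦 (idx Z t)).Λ → ℝ) → ℝ)
    (hχ0 : ∀ Z t B, 0 ≤ χY₀ Z t B) (hχ1 : ∀ Z t B, χY₀ Z t B ≤ 1)
    (Pl : (Z : TDom 4 (𝓣 s₀).N') → (t : Finset (TDom 4 (L * (𝓣 s₀).N')) × Finset (TBond 4 M₃ (L * (𝓣 s₀).N'))) → Finset ((𝓣 s₀).𝒦 (idx Z t)).Λ)
    (hPcard : ∀ Z, ∀ t ∈ terms L M₃ Z, (Pl Z t).card = t.2.card) {rP : ℝ} (hrP : 0 ≤ rP)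
    (hχc : ∀ Z t B, χcP Z t B = ∏ b ∈ Pl Z t, (if rP ≤ |B b| then (1 : ℝ) else 0))
    (Dfam : TDom 4 (𝓣 s₀).N' → Finset (TDom 4 (L * (𝓣 s₀).N')) × Finset (TBond 4 M₃ (L * (𝓣 s₀).N')) → Finset (TDom 4 (L * (𝓣 s₀).N')))
    (Vr : (Z : TDom 4 (𝓣 s₀).N') → (t : Finset (TDom 4 (L * (𝓣 s₀).N')) × Finset (TBond 4 M₃ (L * (𝓣 s₀).N'))) → Wt.Φ →
      TDom 4 (L * (𝓣 s₀).N') → (((𝓣 s₀).𝒦 (idx Z t)).Λ → ℝ) → ℂ)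
    -- (3) termwise domination: ‖H(Z)‖ ≤ Σ_{(𝐃,P)} ‖(2.14)‖ on the space of p. 15 ((2.9)/(2.14))
    (hH : ∀ (Z : TDom 4 (𝓣 s₀).N') (φ : Wt.Φ), φ ∈ Wt.sp2 Z → ‖Wt.H Z φ‖ ≤
      ∑ t ∈ terms L M₃ Z, ‖term214 r (lZ Z t) (lD Z t)
        (core214 (fun σ => ((𝓣 s₀).𝒦 (idx Z t)).A2 σ (uOf Z t φ)) (Γm Z t φ)
          (F214 t.2.card (χY₀ Z t) (χcP Z t) (Dfam Z t) (Vr Z t φ))) 0 0‖)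
    -- (3) the record's objects behind the terms: bonds, cubes, the real field inside the configurations
    (ιb : (Z : TDom 4 (𝓣 s₀).N') → (t : Finset (TDom 4 (L * (𝓣 s₀).N')) × Finset (TBond 4 M₃ (L * (𝓣 s₀).N'))) → ((𝓣 s₀).𝒦 (idx Z t)).Λ → Wt.Bond)
    (hι : ∀ Z t, Function.Injective (ιb Z t)) (cube : Wt.Bond → TPt 4 (L * (𝓣 s₀).N'))
    (hQsupp : ∀ (Y : TDom 4 (L * (𝓣 s₀).N')) φ b b', Wt.Q Y φ b b' ≠ 0 → cube b ∈ Y.1 ∧ cube b' ∈ Y.1)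
    {m' : ℕ} (hfibc : ∀ Z t (x : TPt 4 (L * (𝓣 s₀).N')), (Finset.univ.filter fun j => cube (ιb Z t j) = x).card ≤ m')
    (emb : (Z : TDom 4 (𝓣 s₀).N') → (t : Finset (TDom 4 (L * (𝓣 s₀).N')) × Finset (TBond 4 M₃ (L * (𝓣 s₀).N'))) → Wt.Φ →
      (((𝓣 s₀).𝒦 (idx Z t)).Λ → ℝ) → Wt.Φ)
    (hBv : ∀ Z t φ B b, Wt.Bv (emb Z t φ B) (ιb Z t b) = (B b : ℂ))
    (hBv0 : ∀ Z t φ B b', b' ∉ Set.range (ιb Z t) → Wt.Bv (emb Z t φ B) b' = 0)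
    (hVr : ∀ Z, ∀ t ∈ terms L M₃ Z, ∀ φ ∈ Wt.sp2 Z, ∀ Y ∈ Dfam Z t, ∀ B,
      emb Z t φ B ∈ Wt.sp1 Y → Vr Z t φ Y B = Wt.V Y (emb Z t φ B))
    (hχsupp : ∀ Z, ∀ t ∈ terms L M₃ Z, ∀ φ ∈ Wt.sp2 Z, ∀ B, χY₀ Z t B ≠ 0 → ∀ Y ∈ Dfam Z t,
      emb Z t φ B ∈ Wt.sp1 Y)
    -- (3) REPLACES the separate holomorphy `hΨσ ∕ hΨτ` of the X-integral: the member's kernels entrywise HOLOMORPHIC IN σ on the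
    --     open `e^{κ₁⁺}`-polydisc at the configuration, and measurability of the record's `χ_{k,Y₀}`, potentials, small-field region
    (hAhol : ∀ Z, ∀ t ∈ terms L M₃ Z, ∀ φ ∈ Wt.sp2 Z, ∀ i j, DifferentiableOn ℂ (fun σ => ((𝓣 s₀).𝒦 (idx Z t)).A2 σ (uOf Z t φ) i j)
      {σ : TPt 4 (𝓣 s₀).N' → ℂ | ∀ j, σ j ∈ Metric.ball (0 : ℂ) (Real.exp cp.κ₁)})
    (hGhol : ∀ Z, ∀ t ∈ terms L M₃ Z, ∀ φ ∈ Wt.sp2 Z, ∀ i j, DifferentiableOn ℂ (fun σ => ((𝓣 s₀).𝒦 (idx Z t)).G2 σ (uOf Z t φ) i j)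
      {σ : TPt 4 (𝓣 s₀).N' → ℂ | ∀ j, σ j ∈ Metric.ball (0 : ℂ) (Real.exp cp.κ₁)})
    (hχm : ∀ Z t, Measurable (χY₀ Z t)) (hVm : ∀ Z t φ Y, Measurable (Vr Z t φ Y))
    (hsmallm : ∀ Z t φ, MeasurableSet {B : ((𝓣 s₀).𝒦 (idx Z t)).Λ → ℝ | ∀ Y ∈ Dfam Z t, emb Z t φ B ∈ Wt.sp1 Y})
    -- (3) NODE A's structural inputs at the configuration: A(σ) COMPLEX SYMMETRIC on the polydisc; Γ(σ) = G(σ)·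
    (hAs : ∀ Z, ∀ t ∈ terms L M₃ Z, ∀ φ ∈ Wt.sp2 Z, ∀ σ : TPt 4 (𝓣 s₀).N' → ℂ, (∀ j, ‖σ j‖ ≤ Real.exp cp.κ₁) →
      (((𝓣 s₀).𝒦 (idx Z t)).A2 σ (uOf Z t φ)).IsSymm)
    (hlin : ∀ Z, ∀ t ∈ terms L M₃ Z, ∀ φ ∈ Wt.sp2 Z, ∀ σ : TPt 4 (𝓣 s₀).N' → ℂ, (∀ j, ‖σ j‖ ≤ Real.exp cp.κ₁) →
      ∀ X : ((𝓣 s₀).𝒦 (idx Z t)).Λ ⊕ ((𝓣 s₀).𝒦 (idx Z t)).C₀ → ℝ, Γm Z t φ σ X = ((𝓣 s₀).𝒦 (idx Z t)).G2 σ (uOf Z t φ) *ᵥ fun j => (X j : ℂ))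
    {γ₂ : ℝ} (hγ₂ : 0 ≤ γ₂)
    -- (3) uniform fibre bounds of the bond locations
    {m : ℕ}
    (hfibΛ : ∀ Z t (x : UT (𝓣 s₀).Nf), (Finset.univ.filter fun i => ((𝓣 s₀).𝒦 (idx Z t)).locΛ i = x).card ≤ m)
    (hfibN : ∀ Z t (x : UT (𝓣 s₀).Nf), (Finset.univ.filter fun j => ((𝓣 s₀).𝒦 (idx Z t)).locN j = x).card ≤ m)
    -- (3) THE REFERENCE RUNG's PACKAGE: admissible, an accretivity radius `0 < R₁ < R` with print's two perturbative
    --     sources as FOUR DIVISION-FREE THRESHOLDS, positive input rates and `η ≤ etaMax` of `rf.toWalkPackage R₁` (standard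
    --     rate book: `κ_C = κ_C⋆`, `ρ′ = μ/4`), `α < R₁`, round letters, and PRINT's TWO EXCHANGE THRESHOLDS for a `θ₀ > 0`
    (hrf : rf.Admissible) {R₁ : ℝ} (hR₁ : 0 < R₁) (hR₁R : R₁ < rf.R)
    (hPσ : 8 * rf.KbarP * rf.cV₀ * Real.exp (-(rf.εP * rf.Rσ)) ≤ rf.m₀) (hP₁ : 8 * rf.KbarP * rf.cV₀ * R₁ ≤ rf.m₀ * rf.R)
    (hAσ : 8 * rf.KbarA * rf.cV * Real.exp (-(rf.εA * rf.Rσ)) ≤ rf.mA₀) (hA₁ : 8 * rf.KbarA * rf.cV * R₁ ≤ rf.mA₀ * rf.R)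
    (hp : (rf.toWalkPackage R₁).PositiveRates) (hη : rf.η ≤ (rf.toWalkPackage R₁).etaMax) (hαR : α < R₁)
    {KG KCs θ₀ : ℝ} (hKG : (rf.toWalkPackage R₁).Kbar ≤ KG) (hKCs : 8 / rf.mA₀ ≤ KCs) (hθ₀ : 0 < θ₀)
    (hαsmall : α ≤ θ₀ * R₁ / (4 * (rf.toWalkPackage R₁).Kbar + 4))
    (hRσlarge : Real.log ((4 * (rf.toWalkPackage R₁).Kbar + 4) / θ₀)
      / ((rf.toWalkPackage R₁).mu / 4 - (rf.toWalkPackage R₁).kapCStar) ≤ rf.Rσ)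
    -- (3) rates below the package's κ_C⋆, and NODE A's letter ϑ (θ_Γ = θ_E = θ₀, K_Γ = K_G, K₀′ = K_Cs, θ_C derived)
    {kap kap' kap'' kap₂ ϑ : ℝ} (hkap'' : 0 < kap'') (hk1 : kap'' < kap') (hk2 : kap' < kap) (hk3 : kap < kap₂)
    (hk4 : kap₂ < (rf.toWalkPackage R₁).kapCStar) (hθ₀le : θ₀ ≤ ϑ)
    (hθR1le : (m * (1 + 2 / (kap - kap')) ^ (𝓣 s₀).ν) * (m * (1 + 2 / (kap' - kap'')) ^ (𝓣 s₀).ν)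
      * (θ₀ * KCs * KG
        + KG * (KCs * θ₀ * (m * (1 + 2 / ((rf.toWalkPackage R₁).kapCStar - kap₂)) ^ (𝓣 s₀).ν) * KCs
          * (m * (1 + 2 / (kap₂ - kap)) ^ (𝓣 s₀).ν)) * KG
        + KG * KCs * θ₀) ≤ ϑ)
    (hsmallKθ : KCs * (m * (1 + 2 / kap) ^ (𝓣 s₀).ν) * (ϑ * (m * (1 + 2 / kap'') ^ (𝓣 s₀).ν)) < 1)
    -- (3) the (2.24)–(2.25) smallness with `a₂₀ = m′·α₄·M⁻⁴(1 + 32/(κ₁−1))⁴`; `2∕m_{A,0} ≤ cE`; the form bound of Γ₀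
    {cE : ℝ} (hc0 : 0 ≤ cE)
    (hcE : 2 / rf.mA₀ ≤ cE)
    (hαc : (2 * (ϑ * (m * (1 + 2 / kap'') ^ (𝓣 s₀).ν)) +
      (γ₂ + 2 * (m' * c.α₄ * (c.M ^ 4)⁻¹ * (1 + 32 / (c.κ₁ - 1)) ^ 4))) * cE ≤ 1 / 2)
    (hsmall : (2 * (ϑ * (m * (1 + 2 / kap'') ^ (𝓣 s₀).ν)) +
      (γ₂ + 2 * (m' * c.α₄ * (c.M ^ 4)⁻¹ * (1 + 32 / (c.κ₁ - 1)) ^ 4))) * (1 + 2 * cE * (((rf.toWalkPackage R₁).BΓ * rf.cV) * ((rf.toWalkPackage R₁).BΓ * (m * B6.c0 1 rf.η ^ (𝓣 s₀).ν)) / (rf.mA₀ / 2))) ≤ 1 / 2)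
    -- (3) constant matching, p. 17: `a ≤ γ₂ r_P²` and the volume factor with `w = K₀(64,8)·α₄·#(⋃𝐃)`
    (hPa : a ≤ γ₂ * rP ^ 2)
    (hvol : ∀ Z, ∀ t ∈ terms L M₃ Z,
      2 * (KCs * (m * (1 + 2 / kap) ^ (𝓣 s₀).ν) * (ϑ * (m * (1 + 2 / kap'') ^ (𝓣 s₀).ν))
              * (1 + (1 - KCs * (m * (1 + 2 / kap) ^ (𝓣 s₀).ν) * (ϑ * (m * (1 + 2 / kap'') ^ (𝓣 s₀).ν)))⁻¹) / 2)
          * (Fintype.card ((𝓣 s₀).𝒦 (idx Z t)).Λ : ℝ)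
        + 2 * (K₀ 64 8 * c.α₄ * ((((Dfam Z t).image Subtype.val).biUnion id).card : ℝ))
        + (2 * (ϑ * (m * (1 + 2 / kap'') ^ (𝓣 s₀).ν)) +
            (γ₂ + 2 * (m' * c.α₄ * (c.M ^ 4)⁻¹ * (1 + 32 / (c.κ₁ - 1)) ^ 4))) * cE * (Fintype.card ((𝓣 s₀).𝒦 (idx Z t)).Λ : ℝ)
        + (2 * (ϑ * (m * (1 + 2 / kap'') ^ (𝓣 s₀).ν)) +
            (γ₂ + 2 * (m' * c.α₄ * (c.M ^ 4)⁻¹ * (1 + 32 / (c.κ₁ - 1)) ^ 4))) * (1 + 2 * cE * (((rf.toWalkPackage R₁).BΓ * rf.cV) * ((rf.toWalkPackage R₁).BΓ * (m * B6.c0 1 rf.η ^ (𝓣 s₀).ν)) / (rf.mA₀ / 2)))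
            * (Fintype.card (((𝓣 s₀).𝒦 (idx Z t)).Λ ⊕ ((𝓣 s₀).𝒦 (idx Z t)).C₀) : ℝ)
        ≤ a₅ * ((Z.1).card : ℝ)) :
    B13.Lemma1Printed Wt.toStepData c ∧ B13.Lemma2Printed Wt.toStepData c ∧ B13.Lemma3Printed Wt.toStepData c := by
  have hq : (rf.toWalkPackage R₁).Admissible := RefPackage.admissible_toWalkPackage hrf hR₁
  have hpos := WalkPackage.stdRates_pos (rf.toWalkPackage R₁) hq hp hη
  have hθ : 2 * (rf.toWalkPackage R₁).Kbar *
      (Real.exp (-((((rf.toWalkPackage R₁).stdRates hq hp hη).ρ' - ((rf.toWalkPackage R₁).stdRates hq hp hη).κC) *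
        rf.Rσ)) + α / R₁) ≤ θ₀ :=
    exchange_of_thresholds hq ((rf.toWalkPackage R₁).stdRates hq hp hη) hpos.2.1 hθ₀ hαsmall hRσlarge
  exact b13Leaf_twoTorus_walksRefHolo Wt c k hN12 hL8 hLc S0 F Sq SX T Sc Sq' SX' T' dist h133 hS0Y hFsub hSq hScY hdist0
    hdist hSX hSX' hX0 hAdd hZero hAnT hAnT' hK hK' hκ hδ1 hδκ hκ126 hκ126' hκ₁ hκ₁' hδ₀M hδ₀M5 hR8 hR9 h124 h130
    hθ0 hθ1 hC Gl hVpp hGlAn hGl rd e he hrd s Wf hg hK₂ hR h3 hW hKW hcard hV hQ hsp hvolk hfloor hAnP hG M₃ hN h12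
    hE hε hC₁ hα hM hτ2 cp hκp hr hr1 (fun Z t => (𝓣 s₀).𝒦 (idx Z t)) uOf hαnn huα lZ hlZ lD
    hlD Γm χY₀ χcP hχ0 hχ1 Pl hPcard hrP hχc Dfam Vr hH ιb hι cube hQsupp hfibc emb hBv hBv0 hVr hχsupp hAhol hGhol hχm hVm
    hsmallm hAs hlin hγ₂ hfibΛ hfibN rf hrf hR₁ hR₁R hPσ hP₁ hAσ hA₁ hp hη ((rf.toWalkPackage R₁).stdRates hq hp hη) hpos.1
    hpos.2.1.le hαR (fun Z t _ => termWalksRef_of_uniformWalksAcrossRef hall s₀ (idx Z t)) hKG hKCs hθ hkap'' hk1 hk2 hk3 hk4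
    hθ₀le hθR1le hsmallKθ hc0 hcE hαc hsmall hPa hvol

end Across

end Literature.MathematicalPhysics.QuantumFieldTheory.Balaban1983to89.B13NodeTorusWalksHolo

end
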